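import Literature.Computability.QuantumComplexity.ExactBosonSamplingHardness
import Literature.Computability.Complexity.OracleComputations
import Literature.LinearAlgebra.Matrix.PermanentEntryExpansion
import Mathlib.Data.Nat.Sqrt
import Mathlib.Data.Nat.Log
import Mathlib.Algebra.Order.Round
import Mathlib.Data.Rat.Floor
import HarnessLib

/-!
# Exact permanents from approximate squared permanents: the search of AA13 Thm. 4.3 (math level)

The oracle computation behind Aaronson–Arkhipov's Theorem 4.3 (*The computational complexity of
linear optics*, Theory of Computing 9 (2013), pp. 176–177): given an oracle that returns, for an
integer matrix `M`, a natural number `z` with `Per(M)²/g ≤ z ≤ g · Per(M)²` (`perSqWindow`,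
`ExactBosonSamplingHardness.lean`), the permanent of a `0/1` matrix `X` is computed exactly with
polynomially many adaptive queries — recursion on `n` (the permanent of a minor `Y` with
`Per(Y) ≥ 1`), the identity `Per(X^{[r]}) = Per(X) − r Per(Y)` (eq. (4.3);
`Matrix.permanent_sub_single_zero_zero`), and a search for `r* = Per(X)/Per(Y)` that halves the
oracle value in each of `O(n log n)` rounds (eqs. (4.5)–(4.19)).

This file is the *mathematical* layer: the algorithm as an `OracleComp` (`OracleComputations.lean`)
and its correctness for every oracle whose answers along the run lie in the window. Differences
from the printed proof, all in the direction of using less: (i) the perfect-matching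
normalisation "`x₁₁ = ⋯ = x_{nn} = 1`" is replaced by choosing, with `n` oracle queries, a row
`p` with `x_{p1} = 1` whose minor has nonzero permanent (it exists when `Per(X) ≥ 1`,
`Matrix.exists_permanent_submatrix_pos`) and moving it to the top; (ii) the real quantities
`β = √(g·O)/Per(Y)` are replaced by the rational upper bounds `(⌊√(g v)⌋ + 1)/(D · Per(Y))`
(within a factor `2`, so `L = 3g` grid points suffice for the contraction `4/9`); (iii) queries
are integer matrices: the point `r = s/D` is realised by the matrix with first row
`D · x₁ − s · e₁`, of permanent `D · Per(X) − s · Per(Y)`; (iv) two *clamps* that never act on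
a good run but bound the queries on every run (the query-length clause of `FPRel` concerns all
runs, and an out-of-window answer may be an arbitrarily long string): the half-width numerator
`⌊√(g v)⌋ + 1` is capped at `g (n+1)! D + 1` (`halfK`, `halfK_eq`), and a value `> n!` received
for `Per(Y)` is answered by `0`; likewise the empty minor is never asked (`askMinor`), so every
matrix asked has size `≥ 1`. The queries are built by an abstract *query maker* `mk` indexed by
the call site `(level, phase, round, grid index)`, so that the same development serves the
deterministic oracle (`mk` ignores the index) and the coin-taking oracle of
`PerSqRandOracleSolves` (the index selects a fresh coin block).

**Main result.** `PerSearch.perLevel_correct`: for every `0/1` matrix `X` and every oracle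
whose answers along the run of `perLevel mk g n X` lie in the factor-`g` window
(`PerSearch.GoodRun`), the result is `Per(X)`. Ingredients: the arithmetic of one round
(`search_round`: AA13 (4.9)–(4.15) with rational bounds; `exists_grid_near`; `argminBy_spec`),
the invariant (`SInv`, `searchRound_inv`, `iterM_inv`: (4.5)), the clock and the rounding
(`approx_small_of_decay`, `round_eq_of_approx_small`: (4.16)–(4.19)), the pivot
(`Matrix.exists_permanent_submatrix_pos`, `GoodRun.of_firstM`) and the recursion on the minor.
The polynomial running time of the corresponding step function and the randomised wrapper
(fresh coins per call site, union bound) are separate layers; this file supplies what they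
consume: the query budget `queryCount_perLevel_le` (`budget g n`, AA13's `O(g n² log n)`), the
size invariant of the search (`SzInv`, `searchRound_size`, `iterM_size`: denominators
`≤ (3 g P_Y)^t` — all grid points of a round share the denominator `D · P_Y · 3g`,
`den_gridPt_dvd` — and points `≤ t (g (n+1)! + 1)`, on every run), and the resulting
description of the queries (`perLevel_QB`, for every oracle: every matrix asked has size in
`[1, n]` and entries at most `EBn g n = (3 g n!)^T (2 + T (g n! + 1))` in absolute value, i.e.
polynomially many bits for constant `g`).

## References

* S. Aaronson, A. Arkhipov, *The computational complexity of linear optics*, Theory of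
  Computing 9 (2013) 143–252, Thm. 4.3 and its proof (pp. 176–177), eqs. (4.2)–(4.19).
-/

namespace Literature.Computability.QuantumComplexity.PerSearch

open Complexity Complexity.OracleComp

variable {β γ : Type}

/-- The query list of a sequential composition is the concatenation along the path taken.
(The same statement is `OracleComp.queryList_bind` in `Cryptography/ShorClassicalOracle.lean`,
which cannot be imported here without the Shor development; librarian: hoist both copies into
`OracleComputations.lean`.) [folklore] -/
@[simp] theorem queryList_bind_eq (O : Oracle) (c : OracleComp β) (f : β → OracleComp γ) :
    queryList O (OracleComp.bind c f) = queryList O c ++ queryList O (f (eval O c)) := by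
  induction c with
  | pure b => rfl
  | query q k ih => simp only [OracleComp.bind, queryList, eval, ih (O q), List.cons_append]

/-- The query list of a leaf. [folklore] -/
@[simp] theorem queryList_pure_eq (O : Oracle) (b : β) : queryList O (OracleComp.pure b) = [] := rfl

/-- The query list of a single query (twin of `OracleComp.queryList_ask` of
`Cryptography/ShorClassicalOracle.lean`, see `queryList_bind_eq`). [folklore] -/
@[simp] theorem queryList_ask_eq (O : Oracle) (q : List Bool) : queryList O (ask q) = [q] := rfl

end Literature.Computability.QuantumComplexity.PerSearch

namespace Literature.Computability.QuantumComplexity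

open _root_.Computability Complexity Complexity.OracleComp Matrix Finset

namespace PerSearch

/-! ### Query makers, values, good runs -/

/-- Call sites of the search: (recursion level, phase, round, grid index). [folklore] -/
abbrev Site : Type := ℕ × ℕ × ℕ × ℕ

/-- A **query maker**: the string asked at a call site for an integer matrix. The deterministic
maker ignores the site (`detMaker`); the randomised one appends the coin block of the site
(AA13 p. 178: fresh coins per query). [cite: AaronsonArkhipovToC2013, proof of Thm. 1.1 (p. 178)] -/
abbrev Maker : Type := Site → (Σ n : ℕ, Fin n → Fin n → ℤ) → List Bool

/-- The deterministic query maker: the `Per²`-query `⟨⟨M, 1^k⟩, []⟩` (`perSqQuery`, no coins). [cite: AaronsonArkhipovToC2013, Thm. 4.3 (p. 176)] -/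
def detMaker (k : ℕ) : Maker := fun _ M => perSqQuery M.2 k []

variable (mk : Maker)

/-- Ask the value of the oracle for the matrix `X` at the site `i` (read as a natural number). [cite: AaronsonArkhipovToC2013, proof of Thm. 4.3 (p. 176)] -/
def askV (i : Site) {n : ℕ} (X : Matrix (Fin n) (Fin n) ℤ) : OracleComp ℕ :=
  OracleComp.bind (ask (mk i ⟨n, fun a b => X a b⟩)) fun a => OracleComp.pure (decodeNat a)

/-- `eval` of `askV`. [folklore] -/
@[simp] theorem eval_askV (O : Oracle) (i : Site) {n : ℕ} (X : Matrix (Fin n) (Fin n) ℤ) :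
    eval O (askV mk i X) = decodeNat (O (mk i ⟨n, fun a b => X a b⟩)) := rfl

/-- `queryList` of `askV`. [folklore] -/
@[simp] theorem queryList_askV (O : Oracle) (i : Site) {n : ℕ} (X : Matrix (Fin n) (Fin n) ℤ) :
    queryList O (askV mk i X) = [mk i ⟨n, fun a b => X a b⟩] := rfl

/-- **A good run**: along the run of `c` with oracle `O`, every query made by the maker for a
matrix `M` is answered in the window `[Per(M)²/g, g · Per(M)²]` (AA13 eq. (4.2)). [cite: AaronsonArkhipovToC2013, Thm. 4.3, eq. (4.2) (p. 176)] -/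
def GoodRun (g : ℕ) (O : Oracle) {β : Type} (c : OracleComp β) : Prop :=
  ∀ (i : Site) (M : Σ n : ℕ, Fin n → Fin n → ℤ), mk i M ∈ queryList O c →
    decodeNat (O (mk i M)) ∈ perSqWindow (g : ℝ) M.2

/-- A good run of a composition is good on both parts (along the path taken). [folklore] -/
theorem GoodRun.bind_iff {g : ℕ} {O : Oracle} {β γ : Type} {c : OracleComp β} {f : β → OracleComp γ} :
    GoodRun mk g O (OracleComp.bind c f) ↔ GoodRun mk g O c ∧ GoodRun mk g O (f (eval O c)) := by
  simp only [GoodRun, queryList_bind_eq, List.mem_append]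
  exact ⟨fun h => ⟨fun i M hm => h i M (Or.inl hm), fun i M hm => h i M (Or.inr hm)⟩,
    fun h i M hm => hm.elim (h.1 i M) (h.2 i M)⟩

/-- On a good run, the value asked for `X` lies in the window of `X`. [folklore] -/
theorem GoodRun.askV_mem {g : ℕ} {O : Oracle} {i : Site} {n : ℕ} {X : Matrix (Fin n) (Fin n) ℤ}
    (h : GoodRun mk g O (askV mk i X)) : eval O (askV mk i X) ∈ perSqWindow (g : ℝ) (fun a b => X a b) := by
  rw [eval_askV]
  exact h i ⟨n, fun a b => X a b⟩ (by simp)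

/-- Ask the value of a **minor**: an empty minor has permanent `1` and is not asked (so every
matrix actually asked has size `≥ 1`, the range of `PerSqRandOracleSolves`). [cite: AaronsonArkhipovToC2013, proof of Thm. 4.3 (p. 176)] -/
def askMinor (i : Site) : {n : ℕ} → Matrix (Fin n) (Fin n) ℤ → OracleComp ℕ
  | 0, _ => OracleComp.pure 1
  | _ + 1, Y => askV mk i Y

/-- `askMinor` asks at most one query. [folklore] -/
theorem queryCount_askMinor_le (O : Oracle) (i : Site) {n : ℕ} (Y : Matrix (Fin n) (Fin n) ℤ) :
    queryCount O (askMinor mk i Y) ≤ 1 := by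
  cases n <;> simp [askMinor, askV]

/-- The queries of `askMinor`: none for the empty minor, the one `askV` query otherwise. [folklore] -/
theorem queryList_askMinor (O : Oracle) (i : Site) {n : ℕ} (Y : Matrix (Fin n) (Fin n) ℤ) :
    queryList O (askMinor mk i Y) = (match n, Y with | 0, _ => [] | m + 1, Y => [mk i ⟨m + 1, fun a b => Y a b⟩]) := by
  cases n <;> rfl

/-! ### The window, as arithmetic -/

/-- A window value vanishes iff the permanent does (`g ≥ 1`). [folklore] -/
theorem window_eq_zero_iff {g : ℕ} (hg : 1 ≤ g) {n : ℕ} {X : Fin n → Fin n → ℤ} {z : ℕ}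
    (hz : z ∈ perSqWindow (g : ℝ) X) : z = 0 ↔ (Matrix.of X).permanent = 0 := by
  obtain ⟨h1, h2⟩ := hz
  have hg' : (0 : ℝ) < g := by exact_mod_cast hg
  constructor
  · intro h
    subst h
    have : ((Matrix.of X).permanent : ℝ) ^ 2 ≤ 0 := by
      rw [div_le_iff₀ hg'] at h1; simpa using h1
    have h0 : ((Matrix.of X).permanent : ℝ) ^ 2 = 0 := le_antisymm this (sq_nonneg _)
    exact_mod_cast pow_eq_zero_iff (n := 2) (by norm_num) |>.1 h0
  · intro h
    rw [h] at h2
    simp only [Int.cast_zero, ne_eq, OfNat.ofNat_ne_zero, not_false_eq_true, zero_pow, mul_zero] at h2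
    have : (z : ℝ) = 0 := le_antisymm h2 (Nat.cast_nonneg z)
    exact_mod_cast this

/-- On a good run, **the value of a minor vanishes iff its permanent does** (the empty minor has
permanent `1` and value `1`). [folklore] -/
theorem GoodRun.askMinor_eq_zero_iff {g : ℕ} (hg : 1 ≤ g) {O : Oracle} {i : Site} :
    ∀ {n : ℕ} {Y : Matrix (Fin n) (Fin n) ℤ}, GoodRun mk g O (askMinor mk i Y) →
      (eval O (askMinor mk i Y) = 0 ↔ Y.permanent = 0)
  | 0, Y, _ => by simp [askMinor, Matrix.permanent_isEmpty]
  | n + 1, Y, h => by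
    have h' : GoodRun mk g O (askV mk i Y) := h
    exact window_eq_zero_iff hg (GoodRun.askV_mem mk h')

/-- A window value, normalised by the square of a scaling `D`, is a rational `Approx`imation of
`c²` whenever the permanent is `D · c`. [folklore] -/
theorem window_approx {g : ℕ} {n : ℕ} {X : Fin n → Fin n → ℤ} {z : ℕ} (hz : z ∈ perSqWindow (g : ℝ) X)
    {D : ℕ} (hD : 1 ≤ D) {c : ℚ} (hc : ((Matrix.of X).permanent : ℚ) = D * c) :
    c ^ 2 / g ≤ (z : ℚ) / (D : ℚ) ^ 2 ∧ (z : ℚ) / (D : ℚ) ^ 2 ≤ g * c ^ 2 := by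
  obtain ⟨h1, h2⟩ := hz
  have hD' : (0 : ℚ) < D := by exact_mod_cast hD
  -- move to `ℚ`
  have h1' : (((Matrix.of X).permanent : ℚ) : ℝ) ^ 2 / g ≤ ((z : ℚ) : ℝ) := by simpa using h1
  have h2' : ((z : ℚ) : ℝ) ≤ g * (((Matrix.of X).permanent : ℚ) : ℝ) ^ 2 := by simpa using h2
  have e1 : ((Matrix.of X).permanent : ℚ) ^ 2 / g ≤ (z : ℚ) := by exact_mod_cast h1'
  have e2 : (z : ℚ) ≤ g * ((Matrix.of X).permanent : ℚ) ^ 2 := by exact_mod_cast h2'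
  rw [hc] at e1 e2
  have hD2 : (0 : ℚ) < (D : ℚ) ^ 2 := by positivity
  have hg0 : (0 : ℚ) ≤ g := by positivity
  constructor
  · rw [le_div_iff₀ hD2]
    calc c ^ 2 / (g : ℚ) * (D : ℚ) ^ 2 = ((D : ℚ) * c) ^ 2 / g := by ring
      _ ≤ (z : ℚ) := e1
  · rw [div_le_iff₀ hD2]
    calc (z : ℚ) ≤ g * ((D : ℚ) * c) ^ 2 := e2
      _ = (g : ℚ) * c ^ 2 * (D : ℚ) ^ 2 := by ring


/-- A value `W` approximates the square of the deviation `c` within the factor `g`: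
`c²/g ≤ W ≤ g c²` (AA13 eq. (4.2), normalised). [cite: AaronsonArkhipovToC2013, Thm. 4.3, eq. (4.2) (p. 176)] -/
def Approx (g : ℕ) (c W : ℚ) : Prop :=
  c ^ 2 / g ≤ W ∧ W ≤ g * c ^ 2

/-- An approximation of a square vanishes iff the deviation does. [folklore] -/
theorem Approx.eq_zero_iff {g : ℕ} (hg : 1 ≤ g) {c W : ℚ} (h : Approx g c W) : W = 0 ↔ c = 0 := by
  obtain ⟨h1, h2⟩ := h
  have hg' : (0 : ℚ) < g := by exact_mod_cast hg
  constructor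
  · intro hW
    rw [hW] at h1
    have : c ^ 2 ≤ 0 := by rwa [div_le_iff₀ hg', zero_mul] at h1
    nlinarith [sq_nonneg c]
  · intro hc
    rw [hc] at h2
    have h0 : 0 ≤ W := le_trans (div_nonneg (sq_nonneg c) hg'.le) h1
    nlinarith

/-- The deviation is controlled by the value: `c² ≤ g W`. [cite: AaronsonArkhipovToC2013, proof of Thm. 4.3, eqs. (4.6)–(4.8) (p. 176)] -/
theorem Approx.sq_le {g : ℕ} (hg : 1 ≤ g) {c W : ℚ} (h : Approx g c W) : c ^ 2 ≤ g * W := by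
  have hg' : (0 : ℚ) < g := by exact_mod_cast hg
  have := h.1
  rwa [div_le_iff₀ hg', mul_comm] at this

/-- **The integer square root gives a rational upper bound within a factor two**:
`n ≤ (√n + 1)²` always, and `(√n + 1)² ≤ 4n` for `n ≥ 1` (`√` = `Nat.sqrt`). [folklore] -/
theorem sqrt_succ_sq_bounds (n : ℕ) : n ≤ (Nat.sqrt n + 1) ^ 2 ∧ (1 ≤ n → (Nat.sqrt n + 1) ^ 2 ≤ 4 * n) := by
  constructor
  · exact (Nat.lt_succ_sqrt' n).le
  · intro hn
    have h1 : 1 ≤ Nat.sqrt n := by rw [Nat.le_sqrt]; omega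
    have h2 : Nat.sqrt n ^ 2 ≤ n := by rw [pow_two]; exact Nat.sqrt_le n
    nlinarith

/-- **The grid**: `L + 1` equally spaced points `a − β' + i · (2β'/L)`, `i = 0, …, L`, on
`[a − β', a + β']`; every point of the interval is within `β'/L` of one of them (the nearest,
`round`). [cite: AaronsonArkhipovToC2013, proof of Thm. 4.3 ("divide I into L equal segments") (p. 177)] -/
theorem exists_grid_near {a β' x : ℚ} {L : ℕ} (hL : 1 ≤ L) (hβ : 0 < β') (hx : |x - a| ≤ β') :
    ∃ i : ℕ, i ≤ L ∧ |(a - β' + i * (2 * β' / L)) - x| ≤ β' / L := by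
  have hL' : (0 : ℚ) < L := by exact_mod_cast hL
  set h : ℚ := 2 * β' / L with hh
  have hh0 : 0 < h := by positivity
  -- position of `x` in grid units
  set u : ℚ := (x - (a - β')) / h with hu
  have hu0 : 0 ≤ u := by
    rw [hu]; refine div_nonneg ?_ hh0.le
    have := (abs_le.1 hx).1; linarith
  have huL : u ≤ L := by
    rw [hu, div_le_iff₀ hh0, hh]
    have := (abs_le.1 hx).2
    field_simp
    nlinarith
  set i : ℕ := ⌊u + 1 / 2⌋₊ with hi
  have hi1 : (i : ℚ) ≤ u + 1 / 2 := Nat.floor_le (by linarith)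
  have hi2 : u + 1 / 2 < i + 1 := Nat.lt_floor_add_one _
  refine ⟨i, ?_, ?_⟩
  · have : (i : ℚ) < L + 1 := by linarith
    exact_mod_cast Nat.lt_succ_iff.1 (by exact_mod_cast this : i < L + 1)
  · have hx' : x = a - β' + u * h := by
      rw [hu, div_mul_cancel₀ _ hh0.ne']; ring
    have hd : a - β' + i * (2 * β' / L) - x = (i - u) * h := by rw [hx', hh]; ring
    rw [hd, abs_mul, abs_of_pos hh0]
    have hiu : |(i : ℚ) - u| ≤ 1 / 2 := abs_le.2 ⟨by linarith, by linarith⟩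
    calc |(i : ℚ) - u| * h ≤ 1 / 2 * h := mul_le_mul_of_nonneg_right hiu hh0.le
      _ = β' / L := by rw [hh]; ring

/-- **Rounding recovers the numerator**: if `|q · P − X| < 1/2` for integers `X`, `P`, then
`round (q · P) = X` (AA13: "we can find `r*` exactly, since `r*` equals a rational number
`Per(X)/Per(Y)` where both are integers and `Per(Y)` is known", eq. (4.19)). [cite: AaronsonArkhipovToC2013, proof of Thm. 4.3, eq. (4.19) (p. 177)] -/
theorem round_eq_of_abs_sub_lt {y : ℚ} {X : ℤ} (h : |y - X| < 1 / 2) : round y = X := by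
  rw [round_eq, Int.floor_eq_iff]
  constructor <;> [have := (abs_lt.1 h).1; have := (abs_lt.1 h).2] <;> linarith

/-- **The argmin of a nonempty list by a rational key** (first minimiser; junk `d` on `[]`). [folklore] -/
def argminBy {α : Type} (κ : α → ℚ) (d : α) : List α → α
  | [] => d
  | p :: l => l.foldl (fun acc q => if κ q < κ acc then q else acc) p

/-- The fold keeps a member whose key is below the accumulator's and all later entries'. [folklore] -/
theorem foldl_min_spec {α : Type} (κ : α → ℚ) (l : List α) (p : α) :
    (l.foldl (fun acc q => if κ q < κ acc then q else acc) p ∈ p :: l) ∧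
      κ (l.foldl (fun acc q => if κ q < κ acc then q else acc) p) ≤ κ p ∧
      ∀ q ∈ l, κ (l.foldl (fun acc q => if κ q < κ acc then q else acc) p) ≤ κ q := by
  induction l generalizing p with
  | nil => simp
  | cons a l ih =>
    simp only [List.foldl_cons]
    by_cases h : κ a < κ p
    · rw [if_pos h]
      obtain ⟨h1, h2, h3⟩ := ih a
      refine ⟨List.mem_cons_of_mem p h1, by linarith, fun q hq => ?_⟩
      rcases List.mem_cons.1 hq with rfl | hq
      · exact h2
      · exact h3 q hq
    · rw [if_neg h]
      obtain ⟨h1, h2, h3⟩ := ih p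
      refine ⟨?_, h2, fun q hq => ?_⟩
      · rcases List.mem_cons.1 h1 with h1 | h1
        · rw [h1]; exact List.mem_cons_self
        · exact List.mem_cons_of_mem _ (List.mem_cons_of_mem _ h1)
      · rcases List.mem_cons.1 hq with rfl | hq
        · simp only [not_lt] at h; linarith
        · exact h3 q hq

/-- `argminBy κ d l` is a member of `l` with minimal key (for `l ≠ []`). [folklore] -/
theorem argminBy_spec {α : Type} (κ : α → ℚ) (d : α) {l : List α} (hl : l ≠ []) :
    argminBy κ d l ∈ l ∧ ∀ q ∈ l, κ (argminBy κ d l) ≤ κ q := by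
  cases l with
  | nil => exact absurd rfl hl
  | cons p l =>
    obtain ⟨h1, h2, h3⟩ := foldl_min_spec κ l p
    refine ⟨h1, fun q hq => ?_⟩
    rcases List.mem_cons.1 hq with rfl | hq
    · exact h2
    · exact h3 q hq

/-- **One round of the search contracts the received value by `4/9`.** Data of round `t`: the
current point `r`, the value `W` received for it (normalised by the square of its denominator),
`W ≠ 0`, approximating `c(r)² = (X − r P)²` within `g`; the value `v = W D²` as returned (a
natural number), the half-width `β' = (√(g v) + 1)/(D P)` and `L = 3g`. Then the target
`r* = X/P` lies in `[r − β', r + β']`, and any point `s` within `β'/L` of `r*` has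
`g · c(s)² ≤ (4/9) W` — so the value received for `s`, and a fortiori the minimum over the grid,
is at most `(4/9) W` (AA13 eqs. (4.9)–(4.15) with `L ≥ 2g`, rationalised). [cite: AaronsonArkhipovToC2013, proof of Thm. 4.3, eqs. (4.9)–(4.15) (p. 177)] -/
theorem search_round {g : ℕ} (hg : 1 ≤ g) {X : ℤ} {P D v : ℕ} (hP : 1 ≤ P) (hD : 1 ≤ D) (hv : 1 ≤ v)
    {r : ℚ} (hW : Approx g (X - r * P) ((v : ℚ) / (D : ℚ) ^ 2)) :
    |(X : ℚ) / P - r| ≤ ((Nat.sqrt (g * v) + 1 : ℕ) : ℚ) / ((D : ℚ) * P) ∧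
      ∀ s : ℚ, |s - (X : ℚ) / P| ≤ ((Nat.sqrt (g * v) + 1 : ℕ) : ℚ) / ((D : ℚ) * P) / (3 * g : ℕ) →
        (g : ℚ) * (X - s * P) ^ 2 ≤ 4 / 9 * ((v : ℚ) / (D : ℚ) ^ 2) := by
  set K : ℕ := Nat.sqrt (g * v) + 1 with hK
  have hg' : (0 : ℚ) < g := by exact_mod_cast hg
  have hP' : (0 : ℚ) < P := by exact_mod_cast hP
  have hD' : (0 : ℚ) < D := by exact_mod_cast hD
  have hK' : (0 : ℚ) < K := by rw [hK]; positivity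
  obtain ⟨hs1, hs2⟩ := sqrt_succ_sq_bounds (g * v)
  have hgv : 1 ≤ g * v := Nat.one_le_iff_ne_zero.2 (Nat.mul_ne_zero (by omega) (by omega))
  have hs2 := hs2 hgv
  rw [← hK] at hs1 hs2
  have hs1' : (g : ℚ) * v ≤ (K : ℚ) ^ 2 := by exact_mod_cast hs1
  have hs2' : (K : ℚ) ^ 2 ≤ 4 * (g * v) := by exact_mod_cast hs2
  -- `(X − rP)² ≤ g v / D² ≤ K² / D²`
  have hc : ((X : ℚ) - r * P) ^ 2 ≤ ((K : ℚ) / D) ^ 2 := by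
    have h1 := hW.sq_le hg
    rw [div_pow]
    calc ((X : ℚ) - r * P) ^ 2 ≤ g * ((v : ℚ) / (D : ℚ) ^ 2) := h1
      _ = (g * v) / (D : ℚ) ^ 2 := by ring
      _ ≤ (K : ℚ) ^ 2 / (D : ℚ) ^ 2 := div_le_div_of_nonneg_right hs1' (by positivity)
  have habs : |(X : ℚ) - r * P| ≤ K / D := abs_le_of_sq_le_sq' hc (by positivity) |> fun h => abs_le.2 h
  constructor
  · -- `|X/P − r| = |X − rP| / P ≤ (K/D)/P`
    have e : (X : ℚ) / P - r = ((X : ℚ) - r * P) / P := by field_simp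
    rw [e, abs_div, abs_of_pos hP', div_le_iff₀ hP']
    calc |(X : ℚ) - r * P| ≤ K / D := habs
      _ = (K : ℚ) / ((D : ℚ) * P) * P := by field_simp
  · intro s hs
    -- `|sP − X| ≤ K / (3 g D)`
    have hL : ((3 * g : ℕ) : ℚ) = 3 * g := by push_cast; ring
    rw [hL] at hs
    have hsP : |s * P - X| ≤ (K : ℚ) / (3 * g * D) := by
      have e : s * P - X = (s - (X : ℚ) / P) * P := by field_simp
      rw [e, abs_mul, abs_of_pos hP']
      calc |s - (X : ℚ) / P| * P ≤ (K : ℚ) / ((D : ℚ) * P) / (3 * g) * P := mul_le_mul_of_nonneg_right hs hP'.le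
        _ = (K : ℚ) / (3 * g * D) := by field_simp
    have hsq : ((X : ℚ) - s * P) ^ 2 ≤ ((K : ℚ) / (3 * g * D)) ^ 2 := by
      calc ((X : ℚ) - s * P) ^ 2 = |s * P - X| ^ 2 := by rw [sq_abs]; ring
        _ ≤ ((K : ℚ) / (3 * g * D)) ^ 2 := pow_le_pow_left₀ (abs_nonneg _) hsP 2
    calc (g : ℚ) * ((X : ℚ) - s * P) ^ 2 ≤ g * ((K : ℚ) / (3 * g * D)) ^ 2 := by gcongr
      _ = (K : ℚ) ^ 2 / (9 * g * (D : ℚ) ^ 2) := by field_simp; ring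
      _ ≤ 4 * (g * v) / (9 * g * (D : ℚ) ^ 2) := div_le_div_of_nonneg_right hs2' (by positivity)
      _ = 4 / 9 * ((v : ℚ) / (D : ℚ) ^ 2) := by field_simp


/-- **The final rounding**: once the received value is small, `g W < 1/4`, the current point
determines `X` exactly: `round (r · P) = X`. [cite: AaronsonArkhipovToC2013, proof of Thm. 4.3, eq. (4.19) (p. 177)] -/
theorem round_eq_of_approx_small {g : ℕ} (hg : 1 ≤ g) {X : ℤ} {P : ℕ} {r W : ℚ}
    (hW : Approx g (X - r * P) W) (hsmall : (g : ℚ) * W < 1 / 4) : round (r * P) = X := by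
  apply round_eq_of_abs_sub_lt
  have hc := hW.sq_le hg
  have h : (r * P - X) ^ 2 < (1 / 2) ^ 2 := by
    calc (r * P - X) ^ 2 = ((X : ℚ) - r * P) ^ 2 := by ring
      _ ≤ g * W := hc
      _ < 1 / 4 := hsmall
      _ = (1 / 2) ^ 2 := by norm_num
  exact abs_lt_of_sq_lt_sq' h (by norm_num) |> fun h => abs_lt.2 h

/-- **The number of rounds**: with `2^T > 4 g² B²` (e.g. `T = log₂(4 g² B²) + 1`), an initial
value `W₀ ≤ g B²` and geometric decay `W_T ≤ (4/9)^T W₀` give `g · W_T < 1/4` (AA13 eqs.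
(4.16)–(4.18): `T = O(n log n)` rounds from `O(X) ≤ g (n!)²`). [cite: AaronsonArkhipovToC2013, proof of Thm. 4.3, eqs. (4.16)–(4.18) (p. 177)] -/
theorem approx_small_of_decay {g B T : ℕ} (hg : 1 ≤ g) (hT : 4 * g ^ 2 * B ^ 2 < 2 ^ T) {W₀ WT : ℚ}
    (hW0 : W₀ ≤ g * (B : ℚ) ^ 2) (hWT : WT ≤ (4 / 9) ^ T * W₀) : (g : ℚ) * WT < 1 / 4 := by
  have hg' : (1 : ℚ) ≤ g := by exact_mod_cast hg
  have hT' : (4 : ℚ) * g ^ 2 * B ^ 2 < 2 ^ T := by exact_mod_cast hT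
  have h49 : ((4 : ℚ) / 9) ^ T ≤ 1 / 2 ^ T := by
    rw [one_div, ← inv_pow]; apply pow_le_pow_left₀ (by norm_num) (by norm_num)
  have hpos : (0 : ℚ) < 2 ^ T := by positivity
  have h1 : (g : ℚ) * WT ≤ g * ((4 / 9) ^ T * (g * B ^ 2)) := by
    have : (4 / 9 : ℚ) ^ T * W₀ ≤ (4 / 9) ^ T * (g * B ^ 2) := mul_le_mul_of_nonneg_left hW0 (by positivity)
    nlinarith
  calc (g : ℚ) * WT ≤ g * ((4 / 9) ^ T * (g * B ^ 2)) := h1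
    _ ≤ g * (1 / 2 ^ T * (g * B ^ 2)) := by gcongr
    _ = (g ^ 2 * B ^ 2) / 2 ^ T := by ring
    _ < 1 / 4 := by rw [div_lt_iff₀ hpos]; linarith

/-- `2^(log₂ n + 1) > n`: the clock `T = log₂(4g²B²) + 1` satisfies the hypothesis of
`approx_small_of_decay`. [folklore] -/
theorem lt_two_pow_log_succ (n : ℕ) : n < 2 ^ (Nat.log 2 n + 1) :=
  Nat.lt_pow_succ_log_self (by norm_num) n

/-! ### The algorithm -/

section Algorithm

variable (g : ℕ)

/-- **The integer matrix of the point `r = s/D`**: first row `D · x₀ − s · e₀` — its permanent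
is `D · Per(X) − s · Per(X₀₀)` (`permanent_scaledMatrix`), `D` times AA13's `Per(X^{[r]})`
(eq. (4.3)). [cite: AaronsonArkhipovToC2013, proof of Thm. 4.3, eq. (4.3) (p. 176)] -/
def scaledMatrix {n : ℕ} (X : Matrix (Fin (n + 1)) (Fin (n + 1)) ℤ) (r : ℚ) : Matrix (Fin (n + 1)) (Fin (n + 1)) ℤ :=
  X.updateRow 0 fun j => (r.den : ℤ) * X 0 j - if j = 0 then r.num else 0

/-- **`Per(M_r) = D · Per(X) − s · Per(X₀₀)`** for `r = s/D` in lowest terms. [cite: AaronsonArkhipovToC2013, proof of Thm. 4.3, eq. (4.3) (p. 176)] -/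
theorem permanent_scaledMatrix {n : ℕ} (X : Matrix (Fin (n + 1)) (Fin (n + 1)) ℤ) (r : ℚ) :
    (scaledMatrix X r).permanent =
      r.den * X.permanent - r.num * (X.submatrix Fin.succ Fin.succ).permanent := by
  have he : scaledMatrix X r = X.updateRow 0 ((r.den : ℤ) • X 0) - Matrix.single 0 0 r.num := by
    ext i j
    simp only [scaledMatrix, Matrix.sub_apply, updateRow_apply, Matrix.single_apply]
    by_cases hi : i = 0
    · subst hi
      by_cases hj : j = 0
      · subst hj; simp
      · simp [hj, Ne.symm hj]
    · simp [hi, Ne.symm hi]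
  rw [he, permanent_sub_single_zero_zero, permanent_updateRow_smul, updateRow_eq_self]
  congr 2

/-- In `ℚ`: `Per(M_r) = D · (Per X − r · Per X₀₀)`. [cite: AaronsonArkhipovToC2013, proof of Thm. 4.3, eq. (4.3) (p. 176)] -/
theorem permanent_scaledMatrix_rat {n : ℕ} (X : Matrix (Fin (n + 1)) (Fin (n + 1)) ℤ) (r : ℚ) :
    ((scaledMatrix X r).permanent : ℚ) =
      r.den * ((X.permanent : ℚ) - r * (X.submatrix Fin.succ Fin.succ).permanent) := by
  rw [permanent_scaledMatrix]
  push_cast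
  have hd : (r.den : ℚ) ≠ 0 := by exact_mod_cast r.den_nz
  have : (r.num : ℚ) = r * r.den := by
    have h := Rat.mul_den_eq_num r
    exact_mod_cast h.symm
  rw [this]
  ring

/-- The `i`-th of the `L + 1` grid points of `[r − β', r + β']`. [cite: AaronsonArkhipovToC2013, proof of Thm. 4.3 ("let s(1), …, s(L) be their left endpoints") (p. 177)] -/
def gridPt (r β' : ℚ) (L i : ℕ) : ℚ :=
  r - β' + i * (2 * β' / L)

/-- The key by which grid points are compared: the received value normalised by the square of
the point's denominator (`W = v/D²`, an approximation of `(Per X − r Per Y)²`). [folklore] -/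
def keyW (p : ℚ × ℕ) : ℚ :=
  (p.2 : ℚ) / (p.1.den : ℚ) ^ 2

/-- The numerator `K` of the rational half-width `β' = K/(D · P_Y)`: `⌊√(g v)⌋ + 1`, **clamped**
at the a-priori bound `g (n+1)! D + 1` which it obeys whenever the value `v` lies in the window
of a point of denominator `D` (`halfK_eq`; `Per(X) ≤ (n+1)!` for a `0/1` matrix). The clamp never
acts on a good run; it makes the points, hence the queries, polynomially bounded on *every* run
(the query-length clause of `FPRel` is about all runs). [cite: AaronsonArkhipovToC2013, proof of Thm. 4.3, eq. (4.9) (p. 177)] -/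
def halfK (g n v D : ℕ) : ℕ :=
  min (Nat.sqrt (g * v) + 1) (g * (n + 1).factorial * D + 1)

/-- The clamp bound. [folklore] -/
theorem halfK_le (g n v D : ℕ) : halfK g n v D ≤ g * (n + 1).factorial * D + 1 := min_le_right _ _

/-- `halfK` is positive. [folklore] -/
theorem halfK_pos (g n v D : ℕ) : 0 < halfK g n v D := by unfold halfK; omega

/-- **One round of the search** on the state `(t, r, v)` (round number, current point, value
received for it): if `v = 0` the point is exact and is kept; otherwise the `3g + 1` grid points of
`[r − β', r + β']`, `β' = K/(D · P_Y)` with `K = halfK g n v D` (`= ⌊√(g v)⌋ + 1` on good runs),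
are queried (sites `(lvl, 2, t, i)`) and the point with the least normalised value is kept
together with its value (AA13 eqs. (4.9)–(4.15)). [cite: AaronsonArkhipovToC2013, proof of Thm. 4.3, eqs. (4.9)–(4.15) (p. 177)] -/
def searchRound (lvl : ℕ) {n : ℕ} (X : Matrix (Fin (n + 1)) (Fin (n + 1)) ℤ) (PY : ℕ)
    (st : ℕ × ℚ × ℕ) : OracleComp (ℕ × ℚ × ℕ) :=
  if st.2.2 = 0 then OracleComp.pure (st.1 + 1, st.2.1, st.2.2) else
    OracleComp.bind
      (forEach (fun i : ℕ =>
        OracleComp.bind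
          (askV mk (lvl, 2, st.1, i)
            (scaledMatrix X (gridPt st.2.1 ((halfK g n st.2.2 st.2.1.den : ℕ) / ((st.2.1.den : ℚ) * PY)) (3 * g) i)))
          fun w => OracleComp.pure
            (gridPt st.2.1 ((halfK g n st.2.2 st.2.1.den : ℕ) / ((st.2.1.den : ℚ) * PY)) (3 * g) i, w))
        (List.range (3 * g + 1)))
      fun l => OracleComp.pure (st.1 + 1, (argminBy keyW ((0 : ℚ), 0) l).1, (argminBy keyW ((0 : ℚ), 0) l).2)

/-- The number of rounds at level `n + 1`: `T = log₂(4 g² ((n+1)!)²) + 1` (AA13's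
`T = O(n log n)`, eqs. (4.16)–(4.18)). [cite: AaronsonArkhipovToC2013, proof of Thm. 4.3, eqs. (4.16)–(4.18) (p. 177)] -/
def rounds (n : ℕ) : ℕ :=
  Nat.log 2 (4 * g ^ 2 * ((n + 1).factorial) ^ 2) + 1

/-- **The search for `Per(X)` of a `0/1` matrix `X`**, by recursion on `n` (AA13, proof of
Thm. 4.3): ask the value of `X` (is `Per X = 0`?); find a row `p` with `x_{p0} = 1` whose minor has
nonzero value (`askMinor`); move it to the top (`X'`), recurse on the minor `Y = X'₀₀` to get `P_Y = Per Y`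
(a value `> n!`, impossible on a good run, is clamped to the answer `0`); run `rounds g n` rounds
of `searchRound` from `(0, 0, value of X)`; return `round(r · P_Y)`. [cite: AaronsonArkhipovToC2013, proof of Thm. 4.3 (pp. 176–177)] -/
def perLevel : (n : ℕ) → Matrix (Fin n) (Fin n) ℤ → OracleComp ℕ
  | 0, _ => OracleComp.pure 1
  | n + 1, X =>
    OracleComp.bind (askV mk (n + 1, 0, 0, 0) X) fun v0 =>
      if v0 = 0 then OracleComp.pure 0 else
        OracleComp.bind
          (firstM (fun p : Fin (n + 1) =>
              if X p 0 ≠ 1 then OracleComp.pure none else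
                OracleComp.bind (askMinor mk (n + 1, 1, p, 0) (X.submatrix p.succAbove Fin.succ)) fun b =>
                  OracleComp.pure (if b = 0 then none else some p))
            (List.finRange (n + 1)))
          fun piv =>
            match piv with
            | none => OracleComp.pure 0
            | some p =>
              OracleComp.bind (perLevel n ((X.submatrix (Fin.cons p p.succAbove) id).submatrix Fin.succ Fin.succ))
                fun PY =>
                  if PY = 0 ∨ n.factorial < PY then OracleComp.pure 0 else
                    OracleComp.bind
                      (iterM (searchRound mk g (n + 1) (X.submatrix (Fin.cons p p.succAbove) id) PY)
                        (rounds g n) (0, 0, v0))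
                      fun st => OracleComp.pure (round (st.2.1 * PY)).toNat

end Algorithm

/-! ### Correctness -/

section Correctness

variable {mk} {g : ℕ}

/-- `0/1` matrices. [cite: AaronsonArkhipovToC2013, Thm. 4.2 (p. 175)] -/
def IsZeroOne {m : Type*} (X : Matrix m m ℤ) : Prop :=
  ∀ a b, X a b = 0 ∨ X a b = 1

/-- Entries of a `0/1` matrix are nonnegative. [folklore] -/
theorem IsZeroOne.nonneg {m : Type*} {X : Matrix m m ℤ} (h : IsZeroOne X) (i j : m) : 0 ≤ X i j := by
  rcases h i j with h | h <;> omega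

/-- Entries of a `0/1` matrix are at most `1`. [folklore] -/
theorem IsZeroOne.le_one {m : Type*} {X : Matrix m m ℤ} (h : IsZeroOne X) (i j : m) : X i j ≤ 1 := by
  rcases h i j with h | h <;> omega

/-- Submatrices of `0/1` matrices are `0/1`. [folklore] -/
theorem IsZeroOne.submatrix {m m' : Type*} {X : Matrix m m ℤ} (h : IsZeroOne X) (e f : m' → m) :
    IsZeroOne (X.submatrix e f) := fun _ _ => h _ _

/-- The query list of `forEach` is the concatenation over the list. [folklore] -/
theorem queryList_forEach {α β : Type} (O : Oracle) (f : α → OracleComp β) (l : List α) :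
    queryList O (forEach f l) = l.flatMap fun a => queryList O (f a) := by
  induction l with
  | nil => rfl
  | cons a l ih => simp [forEach, ih]

/-- A good run of `forEach` is good on every item. [folklore] -/
theorem GoodRun.forEach_mem {α β : Type} {O : Oracle} {f : α → OracleComp β} {l : List α}
    (h : GoodRun mk g O (forEach f l)) {a : α} (ha : a ∈ l) : GoodRun mk g O (f a) :=
  fun i M hm => h i M (by rw [queryList_forEach]; exact List.mem_flatMap.2 ⟨a, ha, hm⟩)

/-- `firstM`: the queries of the first item are asked; if it fails, those of the rest. [folklore] -/
theorem queryList_firstM_cons {α β : Type} (O : Oracle) (f : α → OracleComp (Option β)) (a : α) (l : List α) :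
    queryList O (firstM f (a :: l)) = queryList O (f a) ++
      (match eval O (f a) with | some _ => [] | none => queryList O (firstM f l)) := by
  simp only [firstM, queryList_bind_eq]
  cases eval O (f a) <;> rfl

/-- On a good run of `firstM`, the item that succeeds had a good run, and if none succeeds every
item had a good run. [folklore] -/
theorem GoodRun.of_firstM {α β : Type} {O : Oracle} {f : α → OracleComp (Option β)} :
    ∀ {l : List α}, GoodRun mk g O (OracleComp.firstM f l) →
      (∀ a ∈ l, (∀ a' ∈ l, eval O (f a') = none ∨ True) → True) ∧
      ((eval O (OracleComp.firstM f l) = none → ∀ a ∈ l, GoodRun mk g O (f a) ∧ eval O (f a) = none) ∧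
       ∀ b, eval O (OracleComp.firstM f l) = some b → ∃ a ∈ l, GoodRun mk g O (f a) ∧ eval O (f a) = some b)
  | [], _ => ⟨fun _ _ _ => trivial, fun _ a ha => by simp at ha, fun b hb => by simp [OracleComp.firstM] at hb⟩
  | a :: l, h => by
    have hq := queryList_firstM_cons O f a l
    have ha : GoodRun mk g O (f a) := fun i M hm => h i M (by rw [hq]; exact List.mem_append_left _ hm)
    have hev : eval O (OracleComp.firstM f (a :: l)) = (match eval O (f a) with | some b => some b | none => eval O (OracleComp.firstM f l)) := by
      simp only [OracleComp.firstM, eval_bind]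
      cases eval O (f a) <;> rfl
    refine ⟨fun _ _ _ => trivial, ?_, ?_⟩
    · intro hnone
      cases hfa : eval O (f a) with
      | some b => rw [hev, hfa] at hnone; exact absurd hnone (by simp)
      | none =>
        rw [hev, hfa] at hnone
        have hl : GoodRun mk g O (OracleComp.firstM f l) := fun i M hm => h i M (by rw [hq, hfa]; exact List.mem_append_right _ hm)
        have ih := (GoodRun.of_firstM hl).2.1 hnone
        intro a' ha'
        rcases List.mem_cons.1 ha' with rfl | ha'
        · exact ⟨ha, hfa⟩
        · exact ih a' ha'
    · intro b hb
      cases hfa : eval O (f a) with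
      | some b' =>
        rw [hev, hfa] at hb
        cases hb
        exact ⟨a, List.mem_cons_self, ha, hfa⟩
      | none =>
        rw [hev, hfa] at hb
        have hl : GoodRun mk g O (OracleComp.firstM f l) := fun i M hm => h i M (by rw [hq, hfa]; exact List.mem_append_right _ hm)
        obtain ⟨a', ha', hg', he'⟩ := (GoodRun.of_firstM hl).2.2 b hb
        exact ⟨a', List.mem_cons_of_mem _ ha', hg', he'⟩

/-- From a window bound `v / D² ≤ g P_X²` (`D ≥ 1`): `⌊√(g v)⌋ + 1 ≤ g |P_X| D + 1`. [folklore] -/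
theorem sqrt_succ_le_of_window {g : ℕ} {PX : ℤ} {D v : ℕ} (hD : 1 ≤ D)
    (hv : (v : ℚ) / (D : ℚ) ^ 2 ≤ g * (PX : ℚ) ^ 2) : Nat.sqrt (g * v) + 1 ≤ g * PX.natAbs * D + 1 := by
  have hD' : (0 : ℚ) < D := by exact_mod_cast hD
  have hgv : g * v ≤ (g * PX.natAbs * D) ^ 2 := by
    have h1 : (v : ℚ) ≤ g * (PX : ℚ) ^ 2 * (D : ℚ) ^ 2 := by
      rw [div_le_iff₀ (by positivity)] at hv; linarith
    have h2 : ((g * v : ℕ) : ℚ) ≤ ((g * PX.natAbs * D) ^ 2 : ℕ) := by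
      push_cast
      have hg0 : (0 : ℚ) ≤ g := by positivity
      rw [Nat.cast_natAbs, Int.cast_abs]
      calc (g : ℚ) * v ≤ g * (g * (PX : ℚ) ^ 2 * (D : ℚ) ^ 2) := mul_le_mul_of_nonneg_left h1 hg0
        _ = (g * |(PX : ℚ)| * D) ^ 2 := by rw [mul_pow, mul_pow, sq_abs]; ring
    exact_mod_cast h2
  have := Nat.sqrt_le_sqrt hgv
  rw [Nat.sqrt_eq'] at this
  omega

/-- **The clamp does not act on a good run**: if `v / D² ≤ g P_X²` and `|P_X| ≤ (n+1)!` then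
`halfK g n v D = ⌊√(g v)⌋ + 1`. [folklore] -/
theorem halfK_eq {g n : ℕ} {PX : ℤ} {D v : ℕ} (hD : 1 ≤ D) (hv : (v : ℚ) / (D : ℚ) ^ 2 ≤ g * (PX : ℚ) ^ 2)
    (hPX : |PX| ≤ (n + 1).factorial) : halfK g n v D = Nat.sqrt (g * v) + 1 := by
  unfold halfK
  apply min_eq_left
  have h1 := sqrt_succ_le_of_window hD hv
  have h2 : PX.natAbs ≤ (n + 1).factorial := by
    have : (PX.natAbs : ℤ) ≤ (n + 1).factorial := by rw [Int.natCast_natAbs]; exact hPX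
    exact_mod_cast this
  calc Nat.sqrt (g * v) + 1 ≤ g * PX.natAbs * D + 1 := h1
    _ ≤ g * (n + 1).factorial * D + 1 := by gcongr

/-- The state invariant of the search at round `t`: the received value (normalised) approximates
the squared deviation at the current point, and has decayed geometrically from the initial value
`v₀` (AA13 invariant (4.5), here with the factor `4/9`). [cite: AaronsonArkhipovToC2013, proof of Thm. 4.3, eq. (4.5) (p. 176)] -/
def SInv (g : ℕ) (PX : ℤ) (PY v0 t : ℕ) (st : ℕ × ℚ × ℕ) : Prop :=
  st.1 = t ∧ Approx g (PX - st.2.1 * PY) (keyW (st.2.1, st.2.2)) ∧ keyW (st.2.1, st.2.2) ≤ (4 / 9 : ℚ) ^ t * v0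

/-- `keyW (r, v) = v / D²`. [folklore] -/
theorem keyW_eq (r : ℚ) (v : ℕ) : keyW (r, v) = (v : ℚ) / (r.den : ℚ) ^ 2 := rfl

/-- **One round preserves the invariant** (given `Per X' = P_X`, `Per X'₀₀ = P_Y ≥ 1` and good
answers): the contraction `4/9` comes from `search_round` and `exists_grid_near`, the new point
inherits an `Approx`imation from the good answer it received. [cite: AaronsonArkhipovToC2013, proof of Thm. 4.3, eqs. (4.5)–(4.15) (pp. 176–177)] -/
theorem searchRound_inv (hg : 1 ≤ g) {O : Oracle} {lvl n : ℕ} {X : Matrix (Fin (n + 1)) (Fin (n + 1)) ℤ}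
    {PX : ℤ} {PY v0 t : ℕ} (hPX : X.permanent = PX) (hPY : (X.submatrix Fin.succ Fin.succ).permanent = PY)
    (hPY1 : 1 ≤ PY) (hPXle : |PX| ≤ (n + 1).factorial) (hv0 : (v0 : ℚ) ≤ g * (PX : ℚ) ^ 2)
    {st : ℕ × ℚ × ℕ} (hst : SInv g PX PY v0 t st)
    (hgood : GoodRun mk g O (searchRound mk g lvl X PY st)) :
    SInv g PX PY v0 (t + 1) (eval O (searchRound mk g lvl X PY st)) := by
  obtain ⟨t₀, r, v⟩ := st
  obtain ⟨ht, happ, hdec⟩ := hst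
  simp only at ht happ hdec
  subst ht
  by_cases hv : v = 0
  · -- exact point: nothing changes
    subst hv
    have he : eval O (searchRound mk g lvl X PY (t₀, r, 0)) = (t₀ + 1, r, 0) := by simp [searchRound]
    rw [he]
    refine ⟨rfl, happ, ?_⟩
    simp only [keyW_eq, Nat.cast_zero, zero_div] at hdec ⊢
    positivity
  · -- the grid round; the clamp does not act
    have hKeq : halfK g n v r.den = Nat.sqrt (g * v) + 1 := by
      have hW : (v : ℚ) / (r.den : ℚ) ^ 2 ≤ g * (PX : ℚ) ^ 2 := by
        rw [keyW_eq] at hdec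
        refine hdec.trans ?_
        have h49 : (4 / 9 : ℚ) ^ t₀ ≤ 1 := pow_le_one₀ (by norm_num) (by norm_num)
        have hv0' : (0 : ℚ) ≤ v0 := by positivity
        nlinarith
      exact halfK_eq r.den_pos hW hPXle
    set β' : ℚ := ((Nat.sqrt (g * v) + 1 : ℕ) : ℚ) / ((r.den : ℚ) * PY) with hβ'
    set L : ℕ := 3 * g with hL
    set f : ℕ → OracleComp (ℚ × ℕ) := fun i =>
      OracleComp.bind (askV mk (lvl, 2, t₀, i) (scaledMatrix X (gridPt r β' L i))) fun w =>
        OracleComp.pure (gridPt r β' L i, w) with hf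
    have hsr : searchRound mk g lvl X PY (t₀, r, v) =
        OracleComp.bind (forEach f (List.range (L + 1))) fun l =>
          OracleComp.pure (t₀ + 1, (argminBy keyW ((0 : ℚ), 0) l).1, (argminBy keyW ((0 : ℚ), 0) l).2) := by
      simp only [searchRound, hv, if_false]
      rw [hKeq]
    rw [hsr] at hgood ⊢
    rw [GoodRun.bind_iff] at hgood
    obtain ⟨hgoodF, -⟩ := hgood
    set l := eval O (forEach f (List.range (L + 1))) with hl
    have hev : eval O (OracleComp.bind (forEach f (List.range (L + 1))) fun l =>
        OracleComp.pure (t₀ + 1, (argminBy keyW ((0 : ℚ), 0) l).1, (argminBy keyW ((0 : ℚ), 0) l).2)) =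
        (t₀ + 1, (argminBy keyW ((0 : ℚ), 0) l).1, (argminBy keyW ((0 : ℚ), 0) l).2) := by
      simp only [eval_bind]; rfl
    rw [hev]
    have hl' : l = (List.range (L + 1)).map fun i =>
        (gridPt r β' L i, decodeNat (O (mk (lvl, 2, t₀, i) ⟨n + 1, fun a b => scaledMatrix X (gridPt r β' L i) a b⟩))) := by
      rw [hl, eval_forEach]
      refine List.map_congr_left fun i _ => ?_
      simp [hf]
    -- every entry of `l` is a grid point with a good value
    have hentry : ∀ q ∈ l, ∃ i, i ≤ L ∧ q.1 = gridPt r β' L i ∧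
        Approx g (PX - q.1 * PY) (keyW q) := by
      intro q hq
      rw [hl'] at hq
      obtain ⟨i, hi, rfl⟩ := List.mem_map.1 hq
      have hiL : i ≤ L := by have := List.mem_range.1 hi; omega
      refine ⟨i, hiL, rfl, ?_⟩
      -- the good answer
      have hgi : GoodRun mk g O (f i) := hgoodF.forEach_mem hi
      have hw : decodeNat (O (mk (lvl, 2, t₀, i) ⟨n + 1, fun a b => scaledMatrix X (gridPt r β' L i) a b⟩)) ∈
          perSqWindow (g : ℝ) (fun a b => scaledMatrix X (gridPt r β' L i) a b) := by
        have := (GoodRun.bind_iff mk).1 (by simpa [hf] using hgi)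
        exact (GoodRun.askV_mem mk this.1)
      have hper : ((Matrix.of fun a b => scaledMatrix X (gridPt r β' L i) a b).permanent : ℚ) =
          ((gridPt r β' L i).den : ℕ) * ((PX : ℚ) - gridPt r β' L i * PY) := by
        have : (Matrix.of fun a b => scaledMatrix X (gridPt r β' L i) a b) = scaledMatrix X (gridPt r β' L i) := rfl
        rw [this, permanent_scaledMatrix_rat, hPX, hPY]
        push_cast; ring
      exact window_approx hw (gridPt r β' L i).den_pos hper
    -- the list is nonempty and the argmin is an entry
    have hne : l ≠ [] := by rw [hl']; simp
    obtain ⟨hmem, hmin⟩ := argminBy_spec keyW ((0 : ℚ), 0) hne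
    obtain ⟨j, -, hj1, hjapp⟩ := hentry _ hmem
    refine ⟨rfl, ?_, ?_⟩
    · simpa using hjapp
    · -- contraction: some grid point is near `r* = PX / PY`
      have hround := search_round hg (X := PX) hPY1 r.den_pos (Nat.one_le_iff_ne_zero.2 hv)
        (by rw [keyW_eq] at happ; exact happ)
      obtain ⟨hnear, hcontr⟩ := hround
      have hβ0 : 0 < β' := by rw [hβ'] ; positivity
      have hL1 : 1 ≤ L := by rw [hL]; omega
      have hnear' : |(PX : ℚ) / (PY : ℚ) - r| ≤ β' := hnear
      obtain ⟨i, hiL, hi⟩ := exists_grid_near (L := L) hL1 hβ0 hnear'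
      have hiq : (gridPt r β' L i, decodeNat (O (mk (lvl, 2, t₀, i) ⟨n + 1, fun a b => scaledMatrix X (gridPt r β' L i) a b⟩))) ∈ l := by
        rw [hl']; exact List.mem_map.2 ⟨i, List.mem_range.2 (by omega), rfl⟩
      obtain ⟨i', -, hi'1, hi'app⟩ := hentry _ hiq
      simp only at hi'1 hi'app
      have hkey : keyW (gridPt r β' L i, decodeNat (O (mk (lvl, 2, t₀, i) ⟨n + 1, fun a b => scaledMatrix X (gridPt r β' L i) a b⟩))) ≤
          4 / 9 * ((v : ℚ) / (r.den : ℚ) ^ 2) := by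
        have h1 := hi'app.2
        have h2 := hcontr (gridPt r β' L i) hi
        exact h1.trans h2
      calc keyW (argminBy keyW ((0 : ℚ), 0) l) ≤ _ := hmin _ hiq
        _ ≤ 4 / 9 * ((v : ℚ) / (r.den : ℚ) ^ 2) := hkey
        _ ≤ 4 / 9 * ((4 / 9 : ℚ) ^ t₀ * v0) := by rw [keyW_eq] at hdec; gcongr
        _ = (4 / 9 : ℚ) ^ (t₀ + 1) * v0 := by ring


/-- **The rounds preserve the invariant**: after `m` more rounds from round `t`, the invariant
holds at round `t + m`. [cite: AaronsonArkhipovToC2013, proof of Thm. 4.3, eqs. (4.16)–(4.18) (p. 177)] -/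
theorem iterM_inv (hg : 1 ≤ g) {O : Oracle} {lvl n : ℕ} {X : Matrix (Fin (n + 1)) (Fin (n + 1)) ℤ}
    {PX : ℤ} {PY v0 : ℕ} (hPX : X.permanent = PX) (hPY : (X.submatrix Fin.succ Fin.succ).permanent = PY)
    (hPY1 : 1 ≤ PY) (hPXle : |PX| ≤ (n + 1).factorial) (hv0 : (v0 : ℚ) ≤ g * (PX : ℚ) ^ 2) :
    ∀ (m t : ℕ) (st : ℕ × ℚ × ℕ), SInv g PX PY v0 t st →
      GoodRun mk g O (iterM (searchRound mk g lvl X PY) m st) →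
        SInv g PX PY v0 (t + m) (eval O (iterM (searchRound mk g lvl X PY) m st))
  | 0, t, st, h, _ => by simpa [iterM] using h
  | m + 1, t, st, h, hgood => by
    simp only [iterM] at hgood ⊢
    rw [GoodRun.bind_iff] at hgood
    have h1 := searchRound_inv hg hPX hPY hPY1 hPXle hv0 h hgood.1
    have h2 := iterM_inv hg hPX hPY hPY1 hPXle hv0 m (t + 1) _ h1 hgood.2
    rw [eval_bind, show t + (m + 1) = t + 1 + m by omega]
    exact h2

/-- The permanent of the empty matrix. [folklore] -/
theorem permanent_fin_zero (X : Matrix (Fin 0) (Fin 0) ℤ) : X.permanent = 1 :=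
  Matrix.permanent_isEmpty

/-- **Correctness of the search** (AA13, proof of Thm. 4.3): for every `0/1` matrix `X` and
every oracle whose answers along the run lie in the factor-`g` window, the search returns
`Per(X)`. [cite: AaronsonArkhipovToC2013, Thm. 4.3, proof (pp. 176–177)] -/
theorem perLevel_correct (hg : 1 ≤ g) :
    ∀ (n : ℕ) (X : Matrix (Fin n) (Fin n) ℤ), IsZeroOne X → ∀ O : Oracle,
      GoodRun mk g O (perLevel mk g n X) → ((eval O (perLevel mk g n X) : ℕ) : ℤ) = X.permanent := by
  intro n
  induction n with
  | zero =>
    intro X _ O _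
    simp [perLevel, permanent_fin_zero]
  | succ n ih =>
    intro X hX O hgood
    have hPXnn : 0 ≤ X.permanent := permanent_nonneg_of_nonneg X hX.nonneg
    have hPXle : X.permanent ≤ (n + 1).factorial := by
      simpa using permanent_le_factorial X hX.nonneg hX.le_one
    simp only [perLevel] at hgood ⊢
    rw [GoodRun.bind_iff] at hgood
    obtain ⟨hg0, hrest⟩ := hgood
    have hw0 : eval O (askV mk (n + 1, 0, 0, 0) X) ∈ perSqWindow (g : ℝ) (fun a b => X a b) := GoodRun.askV_mem mk hg0
    have hofX : (Matrix.of fun a b => X a b) = X := rfl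
    rw [eval_bind]
    generalize hv0 : eval O (askV mk (n + 1, 0, 0, 0) X) = v0 at hrest hw0
    by_cases hz : v0 = 0
    · -- `Per X = 0`
      have hper0 : X.permanent = 0 := by rw [← hofX]; exact (window_eq_zero_iff hg hw0).1 hz
      subst hz
      simp [hper0]
    · have hper0 : X.permanent ≠ 0 := by rw [← hofX]; exact fun h => hz ((window_eq_zero_iff hg hw0).2 h)
      have hPXpos : 0 < X.permanent := lt_of_le_of_ne hPXnn (Ne.symm hper0)
      simp only [hz, if_false] at hrest ⊢
      rw [GoodRun.bind_iff] at hrest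
      obtain ⟨hgF, hrest⟩ := hrest
      obtain ⟨-, hnone, hsome⟩ := GoodRun.of_firstM hgF
      rw [eval_bind]
      -- the pivot
      set F : Fin (n + 1) → OracleComp (Option (Fin (n + 1))) := fun p =>
        if X p 0 ≠ 1 then OracleComp.pure none else
          OracleComp.bind (askMinor mk (n + 1, 1, (p : ℕ), 0) (X.submatrix p.succAbove Fin.succ)) fun b =>
            OracleComp.pure (if b = 0 then none else some p) with hF
      -- evaluation of `F p` when `x_{p0} = 1`
      have hFev : ∀ p : Fin (n + 1), X p 0 = 1 →
          eval O (F p) = (if eval O (askMinor mk (n + 1, 1, (p : ℕ), 0) (X.submatrix p.succAbove Fin.succ)) = 0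
            then none else some p) := by
        intro p hp
        simp only [hF, hp, ne_eq, not_true_eq_false, if_false, eval_bind]
        rfl
      have hFzero : ∀ p : Fin (n + 1), X p 0 = 1 → GoodRun mk g O (F p) →
          (eval O (askMinor mk (n + 1, 1, (p : ℕ), 0) (X.submatrix p.succAbove Fin.succ)) = 0 ↔
            (X.submatrix p.succAbove Fin.succ).permanent = 0) := by
        intro p hp hgp
        have h' : GoodRun mk g O (OracleComp.bind (askMinor mk (n + 1, 1, (p : ℕ), 0) (X.submatrix p.succAbove Fin.succ))
            fun b => OracleComp.pure (if b = 0 then none else some p)) := by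
          simpa [hF, hp] using hgp
        rw [GoodRun.bind_iff] at h'
        exact GoodRun.askMinor_eq_zero_iff mk hg h'.1
      cases hpiv : eval O (OracleComp.firstM F (List.finRange (n + 1))) with
      | none =>
        exfalso
        obtain ⟨p, hp0, hpos⟩ := exists_permanent_submatrix_pos X hX.nonneg hPXpos
        have hp1 : X p 0 = 1 := by rcases hX p 0 with h | h <;> omega
        obtain ⟨hgp, hep⟩ := hnone hpiv p (List.mem_finRange p)
        rw [hFev p hp1] at hep
        split_ifs at hep with hb
        · have := (hFzero p hp1 hgp).1 hb
          omega
      | some p =>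
        obtain ⟨p', -, hgp, hep⟩ := hsome p hpiv
        have hp1 : X p' 0 = 1 := by
          by_contra h
          simp [h] at hep
        rw [hFev p' hp1] at hep
        split_ifs at hep with hb
        simp only [Option.some.injEq] at hep
        subst hep
        -- `Per (minor p) ≥ 1`
        have hminor_ne : (X.submatrix p'.succAbove Fin.succ).permanent ≠ 0 := fun h0 =>
          hb ((hFzero p' hp1 hgp).2 h0)
        -- the reordered matrix `X'` (row `p'` on top) and its minor `Y = X'₀₀`
        obtain ⟨hPX', hYeq⟩ := permanent_submatrix_cons_succAbove X p'
        have hY : IsZeroOne ((X.submatrix (Fin.cons p' p'.succAbove) id).submatrix Fin.succ Fin.succ) :=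
          (hX.submatrix _ _).submatrix _ _
        have hYper : ((X.submatrix (Fin.cons p' p'.succAbove) id).submatrix Fin.succ Fin.succ).permanent =
            (X.submatrix p'.succAbove Fin.succ).permanent := by rw [hYeq]
        have hYpos : 0 < ((X.submatrix (Fin.cons p' p'.succAbove) id).submatrix Fin.succ Fin.succ).permanent := by
          rw [hYper]
          exact lt_of_le_of_ne (permanent_nonneg_of_nonneg _ (hX.submatrix _ _).nonneg) (Ne.symm hminor_ne)
        -- the recursive call
        rw [hpiv] at hrest
        dsimp only at hrest ⊢
        rw [GoodRun.bind_iff] at hrest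
        obtain ⟨hgY, hrest⟩ := hrest
        have hIH := ih _ hY O hgY
        rw [eval_bind]
        generalize hPY : eval O (perLevel mk g n ((X.submatrix (Fin.cons p' p'.succAbove) id).submatrix Fin.succ Fin.succ)) = PY
          at hrest hIH
        have hPYne : PY ≠ 0 := by
          intro h
          rw [h, Nat.cast_zero] at hIH
          rw [← hIH] at hYpos
          exact lt_irrefl _ hYpos
        have hPY1 : 1 ≤ PY := Nat.one_le_iff_ne_zero.2 hPYne
        -- the clamp `P_Y ≤ n!` does not act
        have hYle : ((X.submatrix (Fin.cons p' p'.succAbove) id).submatrix Fin.succ Fin.succ).permanent ≤ n.factorial := by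
          simpa using permanent_le_factorial _ hY.nonneg hY.le_one
        have hPYle : ¬ n.factorial < PY := by
          have h1 : (PY : ℤ) ≤ n.factorial := hIH ▸ hYle
          omega
        simp only [hPYne, hPYle, or_self, if_false] at hrest ⊢
        rw [GoodRun.bind_iff] at hrest
        obtain ⟨hgS, -⟩ := hrest
        -- the search
        have hPY' : ((X.submatrix (Fin.cons p' p'.succAbove) id).submatrix Fin.succ Fin.succ).permanent = PY := hIH.symm
        have hinv0 : SInv g X.permanent PY v0 0 (0, 0, v0) := by
          refine ⟨rfl, ?_, ?_⟩
          · have hw0' := window_approx hw0 (D := 1) le_rfl (c := (X.permanent : ℚ)) (by rw [hofX]; push_cast; ring)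
            simpa [keyW_eq, Approx] using hw0'
          · simp [keyW_eq]
        have hv0X : (v0 : ℚ) ≤ g * (X.permanent : ℚ) ^ 2 := by
          have h2 := hw0.2
          rw [hofX] at h2
          have h2' : ((v0 : ℚ) : ℝ) ≤ g * ((X.permanent : ℚ) : ℝ) ^ 2 := by simpa using h2
          exact_mod_cast h2'
        have hPXabs : |X.permanent| ≤ (n + 1).factorial := by rw [abs_of_nonneg hPXnn]; exact hPXle
        have hinvT := iterM_inv hg (O := O) (lvl := n + 1) (v0 := v0) hPX' hPY' hPY1 hPXabs hv0X (rounds g n) 0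
          (0, 0, v0) hinv0 hgS
        obtain ⟨-, happT, hdecT⟩ := hinvT
        rw [zero_add] at hdecT
        -- the final rounding
        have hv0le : (v0 : ℚ) ≤ g * (((n + 1).factorial : ℕ) : ℚ) ^ 2 := by
          have h4 : (X.permanent : ℚ) ^ 2 ≤ (((n + 1).factorial : ℕ) : ℚ) ^ 2 := by
            have : (X.permanent : ℚ) ≤ (((n + 1).factorial : ℕ) : ℚ) := by exact_mod_cast hPXle
            have h0 : (0 : ℚ) ≤ X.permanent := by exact_mod_cast hPXnn
            nlinarith
          have hg0 : (0 : ℚ) ≤ g := by positivity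
          nlinarith
        have hsmall := approx_small_of_decay hg (lt_two_pow_log_succ _) hv0le hdecT
        have hround := round_eq_of_approx_small hg happT hsmall
        rw [eval_bind, eval_pure, hround, Int.toNat_of_nonneg hPXnn]

end Correctness

/-! ### The number of queries -/

section Queries

variable (g : ℕ)

/-- The query budget of level `n`: `Q(0) = 0`,
`Q(n+1) = 1 + (n+1) + Q(n) + rounds · (3g + 1)`. [cite: AaronsonArkhipovToC2013, proof of Thm. 4.3 ("O(gn² log n) adaptive queries") (p. 176)] -/
def budget : ℕ → ℕ
  | 0 => 0
  | n + 1 => 1 + (n + 1) + budget n + rounds g n * (3 * g + 1)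

/-- `askV` asks one query. [folklore] -/
@[simp] theorem queryCount_askV (O : Oracle) (i : Site) {n : ℕ} (X : Matrix (Fin n) (Fin n) ℤ) :
    queryCount O (askV mk i X) = 1 := rfl

/-- One search round asks at most `3g + 1` queries. [folklore] -/
theorem queryCount_searchRound_le (O : Oracle) (lvl : ℕ) {n : ℕ} (X : Matrix (Fin (n + 1)) (Fin (n + 1)) ℤ)
    (PY : ℕ) (st : ℕ × ℚ × ℕ) : queryCount O (searchRound mk g lvl X PY st) ≤ 3 * g + 1 := by
  unfold searchRound
  split_ifs with h
  · simp
  · rw [queryCount_bind, queryCount_pure, add_zero]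
    refine (queryCount_forEach_le O _ _ (B := 1) fun i _ => by simp).trans ?_
    simp

/-- **The search asks at most `budget g n` queries**, whatever the oracle (AA13: `O(g n² log n)`
adaptive queries). [cite: AaronsonArkhipovToC2013, proof of Thm. 4.3 (p. 176)] -/
theorem queryCount_perLevel_le :
    ∀ (n : ℕ) (X : Matrix (Fin n) (Fin n) ℤ) (O : Oracle), queryCount O (perLevel mk g n X) ≤ budget g n := by
  intro n
  induction n with
  | zero => intro X O; simp [perLevel, budget]
  | succ n ih =>
    intro X O
    rw [budget]
    simp only [perLevel, queryCount_bind, queryCount_askV]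
    split_ifs with hz
    · simp only [queryCount_pure]; omega
    · rw [queryCount_bind]
      have hF : queryCount O (OracleComp.firstM (fun p : Fin (n + 1) =>
          if X p 0 ≠ 1 then OracleComp.pure none else
            OracleComp.bind (askMinor mk (n + 1, 1, (p : ℕ), 0) (X.submatrix p.succAbove Fin.succ)) fun b =>
              OracleComp.pure (if b = 0 then none else some p)) (List.finRange (n + 1))) ≤ n + 1 := by
        refine (queryCount_firstM_le O _ _ (B := 1) fun p _ => ?_).trans (by simp)
        split_ifs
        · simp
        · rw [queryCount_bind, queryCount_pure, add_zero]
          exact queryCount_askMinor_le mk O _ _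
      generalize eval O (OracleComp.firstM _ (List.finRange (n + 1))) = piv at *
      cases piv with
      | none => simp only [queryCount_pure]; omega
      | some p =>
        simp only [queryCount_bind]
        have h1 := ih ((X.submatrix (Fin.cons p p.succAbove) id).submatrix Fin.succ Fin.succ) O
        generalize eval O (perLevel mk g n _) = PY at *
        split_ifs with hPY
        · simp only [queryCount_pure]; omega
        · rw [queryCount_bind, queryCount_pure, add_zero]
          have h2 := queryCount_iterM_le O (searchRound mk g (n + 1) (X.submatrix (Fin.cons p p.succAbove) id) PY)
            (fun st => queryCount_searchRound_le mk g O (n + 1) _ PY st) (rounds g n) (0, 0, eval O (askV mk (n + 1, 0, 0, 0) X))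
          omega

end Queries

/-! ### Size of the search: denominators and points stay polynomially bounded -/

section Size

variable {mk : Maker} {g : ℕ}

/-- The denominator of `z / m` divides `m`. [folklore] -/
theorem den_div_intCast_natCast_dvd (Z : ℤ) (M : ℕ) : ((Z : ℚ) / (M : ℚ)).den ∣ M := by
  have h := Rat.den_dvd Z M
  rw [Rat.divInt_eq_div] at h
  push_cast at h
  exact Int.natCast_dvd_natCast.1 h

/-- **Grid points share the denominator `D · P_Y · L`**: with `r = a/D` and `β' = K/(D P_Y)`,
`gridPt r β' L i = ((a P_Y − K) L + 2 i K)/(D P_Y L)`, so its denominator divides `D · P_Y · L`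
(and does *not* grow like the product of the summands' denominators). [folklore] -/
theorem den_gridPt_dvd (r : ℚ) (K PY L i : ℕ) (hPY : 0 < PY) (hL : 0 < L) :
    (gridPt r ((K : ℚ) / ((r.den : ℚ) * PY)) L i).den ∣ r.den * PY * L := by
  have hden : 0 < r.den := r.den_pos
  have e : gridPt r ((K : ℚ) / ((r.den : ℚ) * PY)) L i =
      (((r.num * PY - K) * L + 2 * i * K : ℤ) : ℚ) / ((r.den * PY * L : ℕ) : ℚ) := by
    have h1 : (r.den : ℚ) ≠ 0 := by positivity
    have h2 : (PY : ℚ) ≠ 0 := by positivity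
    have h3 : (L : ℚ) ≠ 0 := by positivity
    have hr : (r.num : ℚ) = r * r.den := by exact_mod_cast (Rat.mul_den_eq_num r).symm
    rw [gridPt]
    push_cast
    rw [hr]
    field_simp
  rw [e]
  exact den_div_intCast_natCast_dvd _ _

/-- A grid point with index `i ≤ L` lies within `β'` of the centre. [folklore] -/
theorem abs_gridPt_sub_le {r β' : ℚ} {L i : ℕ} (hβ : 0 ≤ β') (hL : 0 < L) (hi : i ≤ L) :
    |gridPt r β' L i - r| ≤ β' := by
  have hL' : (0 : ℚ) < L := by exact_mod_cast hL
  have hi' : (i : ℚ) ≤ L := by exact_mod_cast hi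
  have h0 : (0 : ℚ) ≤ i * (2 * β' / L) := by positivity
  have h1 : (i : ℚ) * (2 * β' / L) ≤ 2 * β' := by
    rw [mul_div_assoc', div_le_iff₀ hL']
    nlinarith
  rw [gridPt, show r - β' + i * (2 * β' / L) - r = i * (2 * β' / L) - β' by ring, abs_le]
  constructor <;> linarith

/-- **The rational half-width is at most `g (n+1)! + 1` on every run** (the clamp):
`β' = K/(D P_Y) ≤ (g (n+1)! D + 1)/(D P_Y) ≤ g (n+1)! + 1`. [folklore] -/
theorem halfwidth_le {g n v PY D : ℕ} (hPY : 1 ≤ PY) (hD : 1 ≤ D) :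
    ((halfK g n v D : ℕ) : ℚ) / ((D : ℚ) * PY) ≤ g * ((n + 1).factorial : ℕ) + 1 := by
  have hD' : (0 : ℚ) < D := by exact_mod_cast hD
  have hD1 : (1 : ℚ) ≤ D := by exact_mod_cast hD
  have hPY' : (1 : ℚ) ≤ PY := by exact_mod_cast hPY
  have hK : ((halfK g n v D : ℕ) : ℚ) ≤ g * ((n + 1).factorial : ℕ) * D + 1 := by
    exact_mod_cast halfK_le g n v D
  rw [div_le_iff₀ (by positivity)]
  calc ((halfK g n v D : ℕ) : ℚ) ≤ g * ((n + 1).factorial : ℕ) * D + 1 := hK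
    _ ≤ g * ((n + 1).factorial : ℕ) * D + D := by linarith
    _ = (g * ((n + 1).factorial : ℕ) + 1) * D := by ring
    _ ≤ (g * ((n + 1).factorial : ℕ) + 1) * ((D : ℚ) * PY) := by
        apply mul_le_mul_of_nonneg_left _ (by positivity)
        nlinarith

/-- The size invariant at round `t` (level `n + 1`): denominator `≤ (3 g P_Y)^t`, point
`≤ t (g (n+1)! + 1)` in absolute value. It holds along *every* run (no assumption on the
answers). [folklore] -/
def SzInv (g n PY t : ℕ) (st : ℕ × ℚ × ℕ) : Prop :=
  st.2.1.den ≤ (3 * g * PY) ^ t ∧ |st.2.1| ≤ t * (g * ((n + 1).factorial : ℚ) + 1)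

/-- **Sizes of all grid points of a round** from the size invariant: denominators
`≤ (3 g P_Y)^{t+1}` (they divide `D · P_Y · 3g`), absolute values `≤ (t+1)(g (n+1)! + 1)`
(the clamped half-width). [folklore] -/
theorem gridPt_size (hg : 1 ≤ g) {n PY t : ℕ} (hPY1 : 1 ≤ PY) {r : ℚ} {v : ℕ}
    (hden : r.den ≤ (3 * g * PY) ^ t) (habs : |r| ≤ t * (g * ((n + 1).factorial : ℚ) + 1)) {i : ℕ} (hi : i ≤ 3 * g) :
    (gridPt r (((halfK g n v r.den : ℕ) : ℚ) / ((r.den : ℚ) * PY)) (3 * g) i).den ≤ (3 * g * PY) ^ (t + 1) ∧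
      |gridPt r (((halfK g n v r.den : ℕ) : ℚ) / ((r.den : ℚ) * PY)) (3 * g) i| ≤
        (t + 1 : ℕ) * (g * ((n + 1).factorial : ℚ) + 1) := by
  set β' : ℚ := ((halfK g n v r.den : ℕ) : ℚ) / ((r.den : ℚ) * PY) with hβ'
  have hL0 : 0 < 3 * g := by omega
  constructor
  · have hdvd := den_gridPt_dvd r (halfK g n v r.den) PY (3 * g) i (by omega) hL0
    have hle := Nat.le_of_dvd (by positivity) hdvd
    calc (gridPt r β' (3 * g) i).den ≤ r.den * PY * (3 * g) := hle
      _ ≤ (3 * g * PY) ^ t * PY * (3 * g) := by gcongr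
      _ = (3 * g * PY) ^ (t + 1) := by ring
  · have hβle : β' ≤ g * ((n + 1).factorial : ℕ) + 1 := by rw [hβ']; exact halfwidth_le hPY1 r.den_pos
    have hβ0 : 0 ≤ β' := by rw [hβ']; positivity
    have hdist := abs_gridPt_sub_le (r := r) hβ0 hL0 hi
    calc |gridPt r β' (3 * g) i| = |(gridPt r β' (3 * g) i - r) + r| := by ring_nf
      _ ≤ |gridPt r β' (3 * g) i - r| + |r| := abs_add_le _ _
      _ ≤ β' + t * (g * ((n + 1).factorial : ℚ) + 1) := add_le_add hdist habs
      _ ≤ (g * ((n + 1).factorial : ℚ) + 1) + t * (g * ((n + 1).factorial : ℚ) + 1) := by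
          have : β' ≤ g * ((n + 1).factorial : ℚ) + 1 := by exact_mod_cast hβle
          linarith
      _ = (t + 1 : ℕ) * (g * ((n + 1).factorial : ℚ) + 1) := by push_cast; ring

/-- **One round keeps the sizes polynomial, on every run**: the new point is the old one or a
grid point. [folklore] -/
theorem searchRound_size (hg : 1 ≤ g) {O : Oracle} {lvl n : ℕ} {X : Matrix (Fin (n + 1)) (Fin (n + 1)) ℤ}
    {PY t : ℕ} (hPY1 : 1 ≤ PY) {st : ℕ × ℚ × ℕ} (hsz : SzInv g n PY t st) :
    SzInv g n PY (t + 1) (eval O (searchRound mk g lvl X PY st)) := by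
  obtain ⟨t₀, r, v⟩ := st
  obtain ⟨hden, habs⟩ := hsz
  simp only at hden habs
  have hbase : 1 ≤ 3 * g * PY := Nat.one_le_iff_ne_zero.2 (by positivity)
  have hpow : (3 * g * PY) ^ t ≤ (3 * g * PY) ^ (t + 1) := Nat.pow_le_pow_right hbase (by omega)
  have hstep : (t : ℚ) * (g * ((n + 1).factorial : ℚ) + 1) ≤ (t + 1 : ℕ) * (g * ((n + 1).factorial : ℚ) + 1) := by
    push_cast; nlinarith
  by_cases hv : v = 0
  · subst hv
    have he : eval O (searchRound mk g lvl X PY (t₀, r, 0)) = (t₀ + 1, r, 0) := by simp [searchRound]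
    rw [he]
    exact ⟨hden.trans hpow, habs.trans hstep⟩
  · -- the grid round: the new point is a grid point
    set β' : ℚ := ((halfK g n v r.den : ℕ) : ℚ) / ((r.den : ℚ) * PY) with hβ'
    set L : ℕ := 3 * g with hL
    set f : ℕ → OracleComp (ℚ × ℕ) := fun i =>
      OracleComp.bind (askV mk (lvl, 2, t₀, i) (scaledMatrix X (gridPt r β' L i))) fun w =>
        OracleComp.pure (gridPt r β' L i, w) with hf
    have hsr : searchRound mk g lvl X PY (t₀, r, v) =
        OracleComp.bind (forEach f (List.range (L + 1))) fun l =>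
          OracleComp.pure (t₀ + 1, (argminBy keyW ((0 : ℚ), 0) l).1, (argminBy keyW ((0 : ℚ), 0) l).2) := by
      simp only [searchRound, hv, if_false]
      rfl
    rw [hsr]
    set l := eval O (forEach f (List.range (L + 1))) with hl
    have hev : eval O (OracleComp.bind (forEach f (List.range (L + 1))) fun l =>
        OracleComp.pure (t₀ + 1, (argminBy keyW ((0 : ℚ), 0) l).1, (argminBy keyW ((0 : ℚ), 0) l).2)) =
        (t₀ + 1, (argminBy keyW ((0 : ℚ), 0) l).1, (argminBy keyW ((0 : ℚ), 0) l).2) := by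
      simp only [eval_bind]; rfl
    rw [hev]
    have hl' : l = (List.range (L + 1)).map fun i =>
        (gridPt r β' L i, decodeNat (O (mk (lvl, 2, t₀, i) ⟨n + 1, fun a b => scaledMatrix X (gridPt r β' L i) a b⟩))) := by
      rw [hl, eval_forEach]
      refine List.map_congr_left fun i _ => ?_
      simp [hf]
    have hne : l ≠ [] := by rw [hl']; simp
    obtain ⟨hmem, -⟩ := argminBy_spec keyW ((0 : ℚ), 0) hne
    have hpt : ∃ i, i ≤ L ∧ (argminBy keyW ((0 : ℚ), 0) l).1 = gridPt r β' L i := by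
      have hm := hmem
      rw [hl'] at hm ⊢
      obtain ⟨i, hi, hieq⟩ := List.mem_map.1 hm
      exact ⟨i, by have := List.mem_range.1 hi; omega, by rw [← hieq]⟩
    obtain ⟨i, hiL, hpt⟩ := hpt
    simp only [SzInv, hpt]
    exact gridPt_size hg hPY1 hden habs hiL

/-- **All rounds keep the sizes polynomial, on every run.** [folklore] -/
theorem iterM_size (hg : 1 ≤ g) {O : Oracle} {lvl n : ℕ} {X : Matrix (Fin (n + 1)) (Fin (n + 1)) ℤ}
    {PY : ℕ} (hPY1 : 1 ≤ PY) :
    ∀ (m t : ℕ) (st : ℕ × ℚ × ℕ), SzInv g n PY t st →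
      SzInv g n PY (t + m) (eval O (iterM (searchRound mk g lvl X PY) m st))
  | 0, t, st, hsz => by simpa [iterM] using hsz
  | m + 1, t, st, hsz => by
    simp only [iterM]
    have h1 := searchRound_size (mk := mk) (O := O) (lvl := lvl) (X := X) hg hPY1 hsz
    have h2 := iterM_size (O := O) (lvl := lvl) (X := X) hg hPY1 m (t + 1) _ h1
    rw [eval_bind, show t + (m + 1) = t + 1 + m by omega]
    exact h2

/-- Entries of the query matrices are bounded by `D (2 + |r|)` for a `0/1` matrix `X`. [folklore] -/
theorem abs_scaledMatrix_le {n : ℕ} {X : Matrix (Fin (n + 1)) (Fin (n + 1)) ℤ} (hX : IsZeroOne X) (r : ℚ)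
    (i j : Fin (n + 1)) : |(scaledMatrix X r i j : ℚ)| ≤ r.den * (2 + |r|) := by
  have hnum : |(r.num : ℚ)| = |r| * r.den := by
    rw [← Rat.num_div_den r]
    simp only [Rat.num_div_den]
    have : (r.num : ℚ) = r * r.den := by exact_mod_cast (Rat.mul_den_eq_num r).symm
    rw [this, abs_mul, Nat.abs_cast]
  have hd0 : (0 : ℚ) ≤ r.den := by positivity
  by_cases hi : i = 0
  · subst hi
    simp only [scaledMatrix, updateRow_self]
    push_cast
    have hx : (0 : ℚ) ≤ X 0 j ∧ (X 0 j : ℚ) ≤ 1 := ⟨by exact_mod_cast hX.nonneg 0 j, by exact_mod_cast hX.le_one 0 j⟩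
    split_ifs with hj
    · calc |(r.den : ℚ) * X 0 j - r.num| ≤ |(r.den : ℚ) * X 0 j| + |(r.num : ℚ)| := abs_sub _ _
        _ ≤ r.den * 1 + |r| * r.den := by
            rw [hnum, abs_mul, Nat.abs_cast, abs_of_nonneg hx.1]; gcongr; exact hx.2
        _ ≤ r.den * (2 + |r|) := by nlinarith [abs_nonneg r]
    · rw [sub_zero, abs_mul, Nat.abs_cast, abs_of_nonneg hx.1]
      nlinarith [abs_nonneg r, hx.2]
  · simp only [scaledMatrix, updateRow_ne hi]
    have hx : (0 : ℚ) ≤ X i j ∧ (X i j : ℚ) ≤ 1 := ⟨by exact_mod_cast hX.nonneg i j, by exact_mod_cast hX.le_one i j⟩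
    rw [abs_of_nonneg hx.1]
    have : (1 : ℚ) ≤ r.den := by exact_mod_cast r.den_pos
    nlinarith [abs_nonneg r, hx.2]

end Size

/-! ### The matrices asked: sizes in `[1, n]`, entries polynomially bounded -/

section QueryBound

variable {mk : Maker} {g : ℕ}

/-- `QB mk O n B c`: along the run of `c` with `O`, every query is the maker string of a matrix of
size in `[1, n]` all of whose entries are at most `B` in absolute value. [folklore] -/
def QB (mk : Maker) (O : Oracle) (n B : ℕ) {β : Type} (c : OracleComp β) : Prop :=
  ∀ q ∈ queryList O c, ∃ (i : Site) (m : ℕ) (M : Fin m → Fin m → ℤ),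
    q = mk i ⟨m, M⟩ ∧ 1 ≤ m ∧ m ≤ n ∧ ∀ a b, |M a b| ≤ B

/-- `QB` is monotone in the size and entry bounds. [folklore] -/
theorem QB.mono {O : Oracle} {n n' B B' : ℕ} (hn : n ≤ n') (hB : B ≤ B') {β : Type} {c : OracleComp β}
    (h : QB mk O n B c) : QB mk O n' B' c := by
  intro q hq
  obtain ⟨i, m, M, hq', h1, h2, h3⟩ := h q hq
  exact ⟨i, m, M, hq', h1, h2.trans hn, fun a b => (h3 a b).trans (by exact_mod_cast hB)⟩

/-- A leaf asks nothing. [folklore] -/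
theorem QB.pure {O : Oracle} {n B : ℕ} {β : Type} (b : β) : QB mk O n B (OracleComp.pure b) := by
  intro q hq; simp at hq

/-- `QB` of a composition, along the path taken. [folklore] -/
theorem QB.bind_iff {O : Oracle} {n B : ℕ} {β γ : Type} {c : OracleComp β} {f : β → OracleComp γ} :
    QB mk O n B (OracleComp.bind c f) ↔ QB mk O n B c ∧ QB mk O n B (f (eval O c)) := by
  simp only [QB, queryList_bind_eq, List.mem_append]
  exact ⟨fun h => ⟨fun q hq => h q (Or.inl hq), fun q hq => h q (Or.inr hq)⟩,
    fun h q hq => hq.elim (h.1 q) (h.2 q)⟩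

/-- `QB` of a single value query. [folklore] -/
theorem QB.askV {O : Oracle} {n B m : ℕ} {i : Site} {X : Matrix (Fin m) (Fin m) ℤ} (hm1 : 1 ≤ m) (hmn : m ≤ n)
    (hX : ∀ a b, |X a b| ≤ B) : QB mk O n B (askV mk i X) := by
  intro q hq
  rw [queryList_askV, List.mem_singleton] at hq
  exact ⟨i, m, fun a b => X a b, hq, hm1, hmn, hX⟩

/-- `QB` of a minor query (nothing is asked for the empty minor). [folklore] -/
theorem QB.askMinor {O : Oracle} {n B : ℕ} {i : Site} :
    ∀ {m : ℕ} {X : Matrix (Fin m) (Fin m) ℤ}, m ≤ n → (∀ a b, |X a b| ≤ B) → QB mk O n B (askMinor mk i X)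
  | 0, _, _, _ => by intro q hq; simp [queryList_askMinor] at hq
  | m + 1, X, hmn, hX => QB.askV (show 1 ≤ m + 1 by omega) hmn hX

/-- `QB` of `forEach` from `QB` of every item. [folklore] -/
theorem QB.forEach {O : Oracle} {n B : ℕ} {α β : Type} {f : α → OracleComp β} {l : List α}
    (h : ∀ a ∈ l, QB mk O n B (f a)) : QB mk O n B (OracleComp.forEach f l) := by
  intro q hq
  rw [queryList_forEach] at hq
  obtain ⟨a, ha, hq'⟩ := List.mem_flatMap.1 hq
  exact h a ha q hq'

/-- The queries of `firstM` are among those of its items. [folklore] -/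
theorem mem_queryList_firstM {O : Oracle} {α β : Type} {f : α → OracleComp (Option β)} :
    ∀ {l : List α} {q : List Bool}, q ∈ queryList O (OracleComp.firstM f l) → ∃ a ∈ l, q ∈ queryList O (f a)
  | [], q, hq => by simp [OracleComp.firstM] at hq
  | a :: l, q, hq => by
    rw [queryList_firstM_cons, List.mem_append] at hq
    rcases hq with hq | hq
    · exact ⟨a, List.mem_cons_self, hq⟩
    · cases hfa : eval O (f a) with
      | some b => rw [hfa] at hq; simp at hq
      | none =>
        rw [hfa] at hq
        obtain ⟨a', ha', hq'⟩ := mem_queryList_firstM hq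
        exact ⟨a', List.mem_cons_of_mem _ ha', hq'⟩

/-- `QB` of `firstM` from `QB` of every item. [folklore] -/
theorem QB.firstM {O : Oracle} {n B : ℕ} {α β : Type} {f : α → OracleComp (Option β)} {l : List α}
    (h : ∀ a ∈ l, QB mk O n B (f a)) : QB mk O n B (OracleComp.firstM f l) := by
  intro q hq
  obtain ⟨a, ha, hq'⟩ := mem_queryList_firstM hq
  exact h a ha q hq'

/-- Entries of a `0/1` matrix are at most `1` in absolute value. [folklore] -/
theorem IsZeroOne.abs_le_one {m : Type*} {X : Matrix m m ℤ} (h : IsZeroOne X) (a b : m) : |X a b| ≤ 1 := by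
  rcases h a b with h' | h' <;> simp [h']

variable (g)

/-- **The entry bound at level `n + 1`**: `(3 g (n+1)!)^T · (2 + T (g (n+1)! + 1))`, `T = rounds g n`
(denominators `≤ (3 g P_Y)^T`, points `≤ T (g P_X + 1)`, `P_X, P_Y ≤ (n+1)!`). [folklore] -/
def EB (n : ℕ) : ℕ :=
  (3 * g * (n + 1).factorial) ^ rounds g n * (2 + rounds g n * (g * (n + 1).factorial + 1))

/-- The entry bound by level (`0` at level `0`, which asks nothing). [folklore] -/
def EBn : ℕ → ℕ
  | 0 => 0
  | n + 1 => EB g n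

variable {g}

/-- `rounds` is monotone in the level. [folklore] -/
theorem rounds_mono {m n : ℕ} (h : m ≤ n) : rounds g m ≤ rounds g n := by
  unfold rounds
  have hf : (m + 1).factorial ≤ (n + 1).factorial := Nat.factorial_le (by omega)
  have : 4 * g ^ 2 * (m + 1).factorial ^ 2 ≤ 4 * g ^ 2 * (n + 1).factorial ^ 2 :=
    Nat.mul_le_mul_left _ (Nat.pow_le_pow_left hf 2)
  have := Nat.log_mono_right (b := 2) this
  omega

/-- `EB` is monotone in the level (`g ≥ 1`). [folklore] -/
theorem EB_mono (hg : 1 ≤ g) {m n : ℕ} (h : m ≤ n) : EB g m ≤ EB g n := by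
  unfold EB
  have hf : (m + 1).factorial ≤ (n + 1).factorial := Nat.factorial_le (by omega)
  have hT := rounds_mono (g := g) h
  have hb : 1 ≤ 3 * g * (n + 1).factorial := Nat.one_le_iff_ne_zero.2 (by positivity)
  calc (3 * g * (m + 1).factorial) ^ rounds g m * (2 + rounds g m * (g * (m + 1).factorial + 1))
      ≤ (3 * g * (n + 1).factorial) ^ rounds g m * (2 + rounds g n * (g * (n + 1).factorial + 1)) := by
        gcongr
    _ ≤ (3 * g * (n + 1).factorial) ^ rounds g n * (2 + rounds g n * (g * (n + 1).factorial + 1)) :=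
        Nat.mul_le_mul_right _ (Nat.pow_le_pow_right hb hT)

/-- `1 ≤ EB g n` (`g ≥ 1`). [folklore] -/
theorem one_le_EB (hg : 1 ≤ g) (n : ℕ) : 1 ≤ EB g n := by
  unfold EB
  have hb : 1 ≤ 3 * g * (n + 1).factorial := Nat.one_le_iff_ne_zero.2 (by positivity)
  calc 1 ≤ (3 * g * (n + 1).factorial) ^ rounds g n * 1 := by simpa using Nat.one_le_pow _ _ hb
    _ ≤ _ := Nat.mul_le_mul_left _ (by omega)

/-- `EBn` is monotone in the level (`g ≥ 1`). [folklore] -/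
theorem EBn_mono (hg : 1 ≤ g) : ∀ {m n : ℕ}, m ≤ n → EBn g m ≤ EBn g n
  | 0, _, _ => Nat.zero_le _
  | m + 1, n + 1, h => EB_mono hg (by omega)

/-- **The entries asked in a round are at most `EB g n`** (level `n + 1`, round `t < T`, sizes
from the size invariant, `P_Y ≤ (n+1)!`). [folklore] -/
theorem abs_entry_le_EB (hg : 1 ≤ g) {n : ℕ} {X : Matrix (Fin (n + 1)) (Fin (n + 1)) ℤ} (hX : IsZeroOne X)
    {PY t : ℕ} (hPYle : PY ≤ (n + 1).factorial)
    (ht : t + 1 ≤ rounds g n) {pt : ℚ} (hden : pt.den ≤ (3 * g * PY) ^ (t + 1))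
    (habs : |pt| ≤ (t + 1 : ℕ) * (g * ((n + 1).factorial : ℚ) + 1)) (a b : Fin (n + 1)) :
    |scaledMatrix X pt a b| ≤ (EB g n : ℤ) := by
  have h1 := abs_scaledMatrix_le hX pt a b
  -- denominators
  have hb1 : 1 ≤ 3 * g * (n + 1).factorial := Nat.one_le_iff_ne_zero.2 (by positivity)
  have hdenN : pt.den ≤ (3 * g * (n + 1).factorial) ^ rounds g n :=
    calc pt.den ≤ (3 * g * PY) ^ (t + 1) := hden
      _ ≤ (3 * g * (n + 1).factorial) ^ (t + 1) := Nat.pow_le_pow_left (by gcongr) _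
      _ ≤ (3 * g * (n + 1).factorial) ^ rounds g n := Nat.pow_le_pow_right hb1 ht
  have hdenQ : (pt.den : ℚ) ≤ ((3 * g * (n + 1).factorial) ^ rounds g n : ℕ) := by exact_mod_cast hdenN
  -- points
  have htQ : ((t + 1 : ℕ) : ℚ) ≤ (rounds g n : ℕ) := by exact_mod_cast ht
  have hg0 : (0 : ℚ) ≤ g := by positivity
  have habsQ : |pt| ≤ (rounds g n : ℕ) * (g * ((n + 1).factorial : ℕ) + 1) :=
    calc |pt| ≤ (t + 1 : ℕ) * (g * ((n + 1).factorial : ℚ) + 1) := habs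
      _ ≤ (rounds g n : ℕ) * (g * ((n + 1).factorial : ℕ) + 1) := by
          apply mul_le_mul htQ le_rfl (by positivity) (by positivity)
  have hfin : (|scaledMatrix X pt a b| : ℚ) ≤ (EB g n : ℕ) := by
    calc (|(scaledMatrix X pt a b : ℚ)|) ≤ pt.den * (2 + |pt|) := h1
      _ ≤ ((3 * g * (n + 1).factorial) ^ rounds g n : ℕ) * (2 + (rounds g n : ℕ) * (g * ((n + 1).factorial : ℕ) + 1)) := by
          apply mul_le_mul hdenQ (by linarith) (by positivity) (by positivity)
      _ = (EB g n : ℕ) := by simp [EB]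
  exact_mod_cast hfin

/-- **`QB` of one search round, on every run**, from the size invariant at its state. [folklore] -/
theorem searchRound_QB (hg : 1 ≤ g) {O : Oracle} {lvl n : ℕ} {X : Matrix (Fin (n + 1)) (Fin (n + 1)) ℤ}
    (hX : IsZeroOne X) {PY t : ℕ} (hPYle : PY ≤ (n + 1).factorial) (hPY1 : 1 ≤ PY) (ht : t + 1 ≤ rounds g n)
    {st : ℕ × ℚ × ℕ} (hsz : SzInv g n PY t st) {N B : ℕ} (hN : n + 1 ≤ N) (hB : EB g n ≤ B) :
    QB mk O N B (searchRound mk g lvl X PY st) := by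
  obtain ⟨t₀, r, v⟩ := st
  obtain ⟨hden, habs⟩ := hsz
  simp only at hden habs
  by_cases hv : v = 0
  · subst hv
    have he : searchRound mk g lvl X PY (t₀, r, 0) = OracleComp.pure (t₀ + 1, r, 0) := by simp [searchRound]
    rw [he]
    exact QB.pure _
  · unfold searchRound
    simp only [hv, if_false]
    refine QB.bind_iff.2 ⟨QB.forEach fun i hi => QB.bind_iff.2 ⟨?_, QB.pure _⟩, QB.pure _⟩
    have hiL : i ≤ 3 * g := by have := List.mem_range.1 hi; omega
    obtain ⟨hd, ha⟩ := gridPt_size hg (v := v) hPY1 hden habs hiL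
    refine QB.mono hN hB (QB.askV (by omega) le_rfl fun a b => ?_)
    exact abs_entry_le_EB hg hX hPYle ht hd ha a b

/-- **`QB` of the rounds, on every run**, from the size invariant at the start. [folklore] -/
theorem iterM_QB (hg : 1 ≤ g) {O : Oracle} {lvl n : ℕ} {X : Matrix (Fin (n + 1)) (Fin (n + 1)) ℤ}
    (hX : IsZeroOne X) {PY : ℕ} (hPYle : PY ≤ (n + 1).factorial) (hPY1 : 1 ≤ PY) {N B : ℕ}
    (hN : n + 1 ≤ N) (hB : EB g n ≤ B) :
    ∀ (m t : ℕ) (st : ℕ × ℚ × ℕ), t + m ≤ rounds g n → SzInv g n PY t st →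
      QB mk O N B (iterM (searchRound mk g lvl X PY) m st)
  | 0, t, st, _, _ => by simpa [iterM] using QB.pure st
  | m + 1, t, st, htm, hsz => by
    simp only [iterM]
    refine QB.bind_iff.2 ⟨searchRound_QB hg hX hPYle hPY1 (by omega) hsz hN hB, ?_⟩
    have h1 := searchRound_size (mk := mk) (O := O) (lvl := lvl) (X := X) hg hPY1 hsz
    exact iterM_QB hg hX hPYle hPY1 hN hB m (t + 1) _ (by omega) h1

/-- **The matrices asked by the search for a `0/1` matrix — on every run, whatever the oracle —
have sizes in `[1, n]` and entries at most `EBn g n` in absolute value**, i.e. polynomially many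
bits for constant `g` (AA13: the queries `X^{[r]}` have polynomially bounded descriptions; here
unconditionally, thanks to the clamps `halfK` and `P_Y ≤ n!`). [cite: AaronsonArkhipovToC2013, proof of Thm. 4.3 (pp. 176–177)] -/
theorem perLevel_QB (hg : 1 ≤ g) :
    ∀ (n : ℕ) (X : Matrix (Fin n) (Fin n) ℤ), IsZeroOne X → ∀ O : Oracle,
      QB mk O n (EBn g n) (perLevel mk g n X) := by
  intro n
  induction n with
  | zero => intro X _ O; simpa [perLevel] using QB.pure (mk := mk) (O := O) (n := 0) (B := EBn g 0) (1 : ℕ)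
  | succ n ih =>
    intro X hX O
    have hEB1 : 1 ≤ EBn g (n + 1) := one_le_EB hg n
    simp only [perLevel]
    refine QB.bind_iff.2 ⟨QB.askV (by omega) le_rfl fun a b => (hX.abs_le_one a b).trans (by exact_mod_cast hEB1), ?_⟩
    generalize eval O (askV mk (n + 1, 0, 0, 0) X) = v0
    by_cases hz : v0 = 0
    · subst hz; simpa using QB.pure (mk := mk) (O := O) (n := n + 1) (B := EBn g (n + 1)) (0 : ℕ)
    · simp only [hz, if_false]
      set F : Fin (n + 1) → OracleComp (Option (Fin (n + 1))) := fun p =>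
        if X p 0 ≠ 1 then OracleComp.pure none else
          OracleComp.bind (askMinor mk (n + 1, 1, (p : ℕ), 0) (X.submatrix p.succAbove Fin.succ)) fun b =>
            OracleComp.pure (if b = 0 then none else some p) with hF
      have hQF : QB mk O (n + 1) (EBn g (n + 1)) (OracleComp.firstM F (List.finRange (n + 1))) := by
        refine QB.firstM fun p _ => ?_
        simp only [hF]
        split_ifs
        · exact QB.pure _
        · refine QB.bind_iff.2 ⟨QB.askMinor (by omega) fun a b => ?_, QB.pure _⟩
          exact ((hX.submatrix _ _).abs_le_one a b).trans (by exact_mod_cast hEB1)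
      refine QB.bind_iff.2 ⟨hQF, ?_⟩
      cases eval O (OracleComp.firstM F (List.finRange (n + 1))) with
      | none => exact QB.pure _
      | some p' =>
        dsimp only
        have hY : IsZeroOne ((X.submatrix (Fin.cons p' p'.succAbove) id).submatrix Fin.succ Fin.succ) :=
          (hX.submatrix _ _).submatrix _ _
        have hX' : IsZeroOne (X.submatrix (Fin.cons p' p'.succAbove) id) := hX.submatrix _ _
        refine QB.bind_iff.2 ⟨(ih _ hY O).mono (by omega) (EBn_mono hg (by omega)), ?_⟩
        generalize eval O (perLevel mk g n ((X.submatrix (Fin.cons p' p'.succAbove) id).submatrix Fin.succ Fin.succ)) = PY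
        by_cases hc : PY = 0 ∨ n.factorial < PY
        · simp only [hc, if_true]; exact QB.pure _
        · simp only [hc, if_false]
          have hPY1 : 1 ≤ PY := by omega
          have hPYle : PY ≤ (n + 1).factorial := by
            have h2 : n.factorial ≤ (n + 1).factorial := Nat.factorial_le (by omega)
            omega
          refine QB.bind_iff.2 ⟨?_, QB.pure _⟩
          have hsz0 : SzInv g n PY 0 (0, 0, v0) := by simp [SzInv]
          exact iterM_QB hg hX' hPYle hPY1 le_rfl le_rfl (rounds g n) 0 (0, 0, v0) (by omega) hsz0

end QueryBound

end PerSearch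

end Literature.Computability.QuantumComplexity
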